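import Summits.QuantumFields.YangMills.Theorems.BalabanUVNodesN24K1ConsequentOfStubsV19AndChildren
import Summits.QuantumFields.YangMills.Theorems.BalabanUVNodesK1EndOfNodes13PWSOfRunRemAt
import Literature.MathematicalPhysics.QuantumFieldTheory.Balaban1983to89.Node00.CarriersB8SubBP

/-!
# NODE N24 (B2) IN CLOSING POSITION UNDER K0⁷ V19 ∕ K1⁷ v6 (RUN CURRENCY), N05 ON ITS NON-EMPTY P-SLOT: K1⁷'s CONSEQUENT AND THE v6 RUNG-2″ BODY `RunRowsAtSomeRecord13PWS` AT THE WITNESS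
# FROM THE TEN TRACK-A CHILDREN (SPLIT, WORLD-FREE) AND NODE O's RUN ROWS OF THE WITNESS's β OF RECORD — the world BUILT by N24 with its ceiling READ OFF THE ROWS (`β⁺ := B + r`), so the
# match `B + r ≤ w.βup` is `le_rfl`; NO pointwise β-floor, NO `0 < b` letter, NO box ceiling on the END road (dag-n24-w1 g2's run-letter END road `stabilityB_body_of_rung1At_of_runLetters`)

TRACK A (YM-PLAN §2d, node N24 of 28 = binder B2 `hB : B16.EndStatementBPrinted D.C`), seat `pub-ymgap-dag-n24-c` (R134 fan-out seat, strategy s2; gen 9, Part 24).  Key of record: K1⁷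
`StabilityBAtRecordR13SepCoPH` = stmt-QuantumFields-20542; this file `--supports` it as a helper (Summits lane).  Skeletons of record: K0⁷ V19 (87879403b3a26109); K1⁷ **v6** (plan g82,
REGISTERED 03:16Z 2026-08-28: stub 1 `stub_nodes13PWS` UNCHANGED, stub 2″ `stub_runRows13PWS : NodesAtSomeRecord13PWS F → RunRowsAtSomeRecord13PWS F` in the RUN currency, composition
through dag-n24-w1's `K1EndOfNodes13PWSOfRunRemAt.stabilityB_body_of_rung1At_of_runLetters`, p598782).
WHY.  Part 23 (`…N24K1OfStubsV19ChildrenSplitWorldBuilt`) splits the children-uniform hypothesis into world-free per-lane hypotheses (N05 on the P-slot — the H-slot is EMPTY, dag-n05-d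
p585094) and builds the world; its K1-consequent form still reads NODE O in v5's POINTWISE currency (`hO : ∃ b > 0, ∃ γO > 0, BetaLowerH b γO β₁₃(θ)` — the floor `WorldP.b_pos` forces on
Part 8's END road) and K0's box ceiling `hhi`.  Under v6 the END road of record is dag-n24-w1's run-letter road, which reads β ALONG THE RUNS only: a run-wise constant remainder
`RunConstRemainder β_θ b r γ₀` vs SOME bounded reference sequence (`b ≤ B`), the ceiling match `B + r ≤ w.βup`, and a run-wise partial-sum floor `−M` — NO pointwise floor, NO box.  THIS
FILE puts N24 in closing position on THAT road: the ten Track-A children SPLIT exactly as in Part 23 (`h05 … hUV`, same TYPES letter for letter, N05 on the P-slot), NODE O's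
contribution = the RUN ROWS of the witness's β of record `betaOfRecord₁₃ F N θ₁₅ᶜᶜᴹᵂ(j; γ; …)` on SOME level `γR > 0` (letters `b r γR B M` free), and the world BUILT by N24 with
`β⁺ := B + r` READ OFF THE ROWS (so the match is `le_rfl`), `γ := min γ γ₉ γ₁₁ γ₁₃`, `e₋, e₊ :=` N13's, `b := 1`, `β₀ := 1`, `g_R := 0` (free letters: the run-letter END road never reads `w.b`),
`L := θ.L`, `up :=` the S-binding over the four-pin view of the P-X-pinned parameter.  The rung-1 data AT THIS WORLD are assembled from Part 8's X′-generic pointed pieces BY NAME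
(`N24_recordS₁₃SepCoPH_of_upS_rebindX_view`, `N24_nodes₁₃CoPH_rebindXS_fourPin_pointed` at the P-X-pinned carrier map `X′ᴾ` = dag-n05-w4's `XPinned₁₃P θ lam8 lam12 lam13` written out, sockets by `rfl`; guard ∕
`Admissible` ∕ (R₁₃) at the witness as in Part 10's door), then dag-n24-w1's END road.
§1–§2: general `N`, door letters fixed — §1 K1⁷'s consequent; §2 the v6 RUNG-2″ BODY (`RunRowsAtSomeRecord13PWS`'s text with `RecordS` unfolded, general `N`) — rows handed through, match
discharged.  §3–§4: `N = 2`, from V19's three stub texts at `F` (Part 19's opening verbatim) with the children AND the rows as families over Part 14's door letters.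
So «WHICH CHILD BLOCKS K1⁷» (closing form, V19∕v6): V19's three print stubs + one world-free hypothesis per lane N05–N13 (Part 23's types) + NODE O's RUN ROWS at the witness (`hrowsF`);
K0's box enters ONLY the door's provisos ((2.7)-smallness), no longer the END road.  A NEW importing module (imports Part 19 + dag-n24-w1's p598782 + dag-n05-w1's `Node00.CarriersB8SubBP`).  THEOREMS ONLY, def-free, sorry-free, standard axioms.

HONEST FRAMING: composition BY NAME; nothing of Bałaban's asserted — the stub texts, the ten children hypotheses and the run rows are DISPLAYED (the rows' lower half, [II] (2.41), is not a
theorem of the series — T09.F); K0⁷ ∕ K1⁷ NOT closed; no stub closed; N24 COMPOSITE — no discharge, no count moved (5∕27 · A 5∕28); one finite 𝕋⁴ programme at fixed ε; R4 = the conditional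
finite-𝕋⁴ rung `BalabanLadder.UV` only — NOT continuum ∕ ℝ⁴ ∕ OS ∕ mass gap ∕ Clay.
-/

noncomputable section

open scoped Matrix.Norms.L2Operator BigOperators

namespace Summit.QuantumFields.YangMills.BalabanUVNodes.N24K1OfStubsV19ChildrenSplitRunRowsWorldBuilt

open Literature.MathematicalPhysics.QuantumFieldTheory.Balaban1983to89
open Literature.MathematicalPhysics.QuantumFieldTheory.Balaban1983to89.Node00
open DagBinding T4Continuum T4DatumAssembly FlowStepRuns AveragingRT
open FlowStep (BetaLowerH BetaUpperH RGEqH prefixOf)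
open Summit.QuantumFields.YangMills.BalabanUVNodes.N07Thm1Top7FromProp8 (variationalThm1RegSepCoP7M_of_prop8TopStep)
open Summit.QuantumFields.YangMills.Theorems.K0PrintCubeOfStepTokensR (gauge9Supplier_of_prop6MemberP)
open Summit.QuantumFields.YangMills.BalabanUVNodes.N24K1ConsequentOfStubsV19AndChildren (windowLetters_of_absBetaBoxH)
open Summit.QuantumFields.YangMills.Theorems.BalabanUVNodesK2NamedJetsRunRemAt (RunConstRemainder)
open Summit.QuantumFields.YangMills.BalabanUVNodes.K1EndOfNodes13PWSOfRunRemAt (stabilityB_body_of_rung1At_of_runLetters)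

variable {F : T4Family}

/-! ## §1–§2. General `N`, door letters fixed: K1⁷'s consequent and the v6 rung-2″ body from the ten split children (N05 on the P-slot) and the run rows, the world BUILT with `β⁺ := B + r` -/

section generalN

variable {N : ℕ} [NeZero N]

/-- **★★★ K1⁷'s θ-KEYED CONSEQUENT AT THE WITNESS (general `N`, door letters fixed) FROM THE TEN WORLD-FREE TRACK-A CHILDREN HYPOTHESES (N05 ON THE P-SLOT) AND NODE O's RUN ROWS OF THE WITNESS's
β OF RECORD — the world built here with `β⁺ := B + r`** (v6's END road).  Children TYPES = Part 23's: N05 ([B8], ★ P-SLOT): SOME residual [B8] layer carries the SURVIVING leaf over the P-members `B8LeafOfRecordSubBP θ₃ lam8` (dag-n05-w1 `CarriersB8SubBP`; suppliers dag-n05-d D9b∕D9c p596490∕p597296 modulo displayed hypotheses) — NOT the H-slot `B8LeafOfRecordSubBH`, which `B8Prop3ShellModeVacuity.not_b8LeafOfRecordSubBH` (p585094) certifies EMPTY at every θ with `2 ≤ θ.D` (`h05`); N06 ([B9]): SOME operator layer `(M⋆, ops)` carries `B9LeafX (Y9OfRecord …)` (`h06`); N07 ([B11]): SOME residual `ζ`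 carries `B11Leaf (Z11OfRecord F N ζ)` — θ-FREE (`h07`); N08 ([B10]): `PrintedUV3V N F.L` — θ-FREE (`θ₁₅ᶜᶜᴹᵂ.L = F.L`, `rfl`) (`h08`); N09 ([B12] Lemma 4): SOME [B12] residual layer with Lemma 4 on every run (`h09`); N09 ([B12] Thm 3): for SOME coupling threshold `γ₉ > 0`, small couplings ⇒ inductive small-field assumption at EVERY world bound to the door's datum with `w.γ ≤ γ₉` (dag-n09-w2∕w3's junction vocabulary `(hC : w.C = …)`; their all-world doors take `γ₉ := 1`) (`h09T`); N10 ([B13]): SOME run-indexed [B13] residual layer with `B13LeafOfRecord` on every run (`h10`); N11 ([III] (S1ᵀ)): for EVERY ceiling∕floor letter pair `(β⁺, β₀)` the world may carry, SOME coupling threshold `γ₁₁(β⁺, β₀) > 0` such that at EVERY world bound to the door's datum with `w.βup = β⁺`, `w.β₀ = β₀`, `w.γ ≤ γ₁₁`, Part 14's (S1ᵀ) implication holds verbatim (N24 instantiates at its own letters `β⁺ := β′` resp. `B + r`, `β₀ := 1` — so N11 may let its threshold depend on the flow-control constants it is handed) (`h11`); N12 ([B15]): SOME [B15] residual layer with `B15Leaf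 (WOfRecord₁₃ …)` on every run and the selector bound `1 ≤ K → kSel < K` (`h12`); N13 ([III] Cor. 3 ∕ (UV₁₃)): for SOME threshold `γ₁₃ > 0` and SOME exponent functions `e₋, e₊`, the density sandwich on runs with couplings in `]0, γ₁₃]` (`hUV`).  NODE O's rows (letters `b r γR B M` free): `hγR : 0 < γR`,
`hrem : RunConstRemainder β₁₃(θ) b r γR` (DEF-1's run-wise constant remainder, [I] Thm 3 p.264 ∕ (5.10)), `hbB : ∀ k, b k ≤ B`, `hps` (the run-wise partial-sum floor `−M`, [II] (2.41) —
unprinted as a theorem, T09.F).  NO `hO`, NO `hhi`.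
PROOF.  Open the existentials; `γw := min γ (min γ₉ (min γ₁₁ γ₁₃))`; the world `w := ⟨datum.C, γw, e₋, e₊, β⁺, 1, _, b, _, θ.L, _, 0, up⟩` with `up :=` the S-binding over the FOUR-PIN VIEW OF THE P-X-PINNED PARAMETER `(θᴴ.rebindX X′ᴾ).view₁₃CoPHB10YZW Mstar ops ζ lamW`, `X′ᴾ P := (((θ.res.X P).withB8OfRecordSubBP θ₃ lam8).withB12 (F12OfRecord₁₂ θ₁₂ lam12 P) (lam12 P).consts).withB13OfRecord θ₃ (lam13 P)` — WRITTEN OUT (it is dag-n05-w4's `XPinned₁₃P θ lam8 lam12 lam13` ∕ `θᴴ.pinX3P`, `rfl`, whose Node00 module `Record13CarriersXPinnedP` is in flight; no definition introduced here, and nothing in the STATEMENTS reads the pin); binding by `rfl`; guard ∕ `Admissible` ∕ (R₁₃) at the witness BY NAME exactly as in Part 10's door (K0a `ZrUnity.ofHistoryBlind` ∘ `finsum_ζ0_ZrOfRecord₁₃`, dag-n21-c `slotsNondegenerate₁₃_theta13OfThm1CCMW` ∕ `admissible_theta13OfThm1CCMW_of_le_half`, Part 10 §0 `N24_laws₁₃CoPH_theta13OfThm1CCMW`);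 Part 8's X′-GENERIC engine at `X' := X′ᴾ` (the three sockets — N05's P-slot, N09's Lemma 4 at the [B12] frame of record, N10's [B13] leaf — hold by `rfl`, dag-n05-w4's `socket05S_view₁₃CoPHB10YZW_pinX3P_iff` ∕ `socket09∕10_pinX3P_iff`); `hUV` at `γw` by `B14Cor3.inInterval_of_le`; `h09T`∕`h11` at `(w, rfl)` — here Part 8's `N24_recordS₁₃SepCoPH_of_upS_rebindX_view` (the `RecordS` conjunct) and
`N24_nodes₁₃CoPH_rebindXS_fourPin_pointed` (the thirteen nodes); then dag-n24-w1's `stabilityB_body_of_rung1At_of_runLetters` with `hmatch := le_rfl`.  COMPOSITE and CONDITIONAL: every hypothesis displayed; nothing of Bałaban asserted; K0⁷ ∕ K1⁷ NOT closed; no stub closed; no count moved. [cite: Balaban1989LargeFieldII, Thm 1 p.355, (0.1) pp.355–356, p.391; Balaban1988Convergent, Thm 1 p.262, Cor. 3 (2.50) p.264, (2.6) p.255, (3.16)–(3.23) pp.268–270; Balaban1987RG1, Thm 1 p.255, Thm 2 p.259, Thm 3 p.264, Lemma 4 p.280, (0.17)–(0.20) pp.255–256, (1.20)–(1.22) p.264,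 (5.10) p.293; Balaban1988RG2Cluster, (2.41) p.21, Lemmas 1–3 pp.9–20; Balaban1985Variational, Thm 1 (8)–(9) p.279, Prop. 8 p.304; Balaban1985RegularSpaces, Lemma 1 p.79 – Thm 8 p.101, Prop. 6 p.99; Balaban1985UV3, Thm 1 p.257; Balaban1989LargeFieldI, Prop. 1 p.194 (bookkeeping)] -/
theorem N24_stabilityBR13SepCoPH_worldBuilt_childrenSplit_runRows_theta13OfThm1CCMW_of_gauge9TopStepR_of_betaBoxSignFree_allTorus_door {j c : ℕ} {γ ε₀ ε₂₉ B₃ B₃' a₀ a₁ : ℝ} (hγ₀ : 0 < γ) (hγh : γ ≤ 1 / 2)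
    (hε : 0 < ε₀) (hε' : 0 < ε₂₉) (hB : 0 ≤ B₃) (hB' : 0 ≤ B₃') (ha₀ : 0 < a₀) (ha₁ : 0 < a₁)
    (h15 : VariationalThm1RegSepCoP7M F N B₃ a₀ a₁) (hc : c ≤ F.L ^ j)
    (h9 : Gauge9RegSepTopStepR F N (fun ν K Ω => suppDomOfRecord F ν K Ω) (F.L ^ j) c B₃ B₃' a₀ a₁)
    {bl β' : ℝ} (hbox : BetaLowerH bl γ (betaOfRecord₁₃ F N (theta13OfThm1CCMW F N j γ ε₀ ε₂₉ B₃ B₃' a₀ a₁)))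
    (hbox' : BetaUpperH β' γ (betaOfRecord₁₃ F N (theta13OfThm1CCMW F N j γ ε₀ ε₂₉ B₃ B₃' a₀ a₁))) (hl : -bl * γ ^ 2 ≤ 3) (hβ' : β' * γ ^ 2 ≤ 3 / 4)
    (h05 : ∃ lam8 : ResidB8 (theta13OfThm1CCMW F N j γ ε₀ ε₂₉ B₃ B₃' a₀ a₁).toStage3Params, B8LeafOfRecordSubBP (theta13OfThm1CCMW F N j γ ε₀ ε₂₉ B₃ B₃' a₀ a₁).toStage3Params lam8)
    (h06 : ∃ (Mstar : ℕ) (ops : OpsY N (theta13OfThm1CCMW F N j γ ε₀ ε₂₉ B₃ B₃' a₀ a₁).toStage3Params Mstar), B9LeafX (Y9OfRecord N (theta13OfThm1CCMW F N j γ ε₀ ε₂₉ B₃ B₃' a₀ a₁).toStage3Params Mstar ops))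
    (h07 : ∃ ζ : ResidZ F N, B11Leaf (Z11OfRecord F N ζ))
    (h08 : PrintedUV3V N F.L)
    (h09 : ∃ lam12 : ResidB12 F N (theta13OfThm1CCMW F N j γ ε₀ ε₂₉ B₃ B₃' a₀ a₁).τ9.M,
      ∀ P : B12.RunParams, B12Sec2to5.Lemma4Printed (F12OfRecord₁₂ F N (theta13OfThm1CCMW F N j γ ε₀ ε₂₉ B₃ B₃' a₀ a₁).toStage12Params lam12 P) (lam12 P).consts)
    (h09T : ∃ γ₉ : ℝ, 0 < γ₉ ∧ ∀ w : WorldP, w.C = (datumOfRecord₁₃SepCoPH F N (Stage13HParams.ofHistoryBlind F N ⟨theta13OfThm1CCMW F N j γ ε₀ ε₂₉ B₃ B₃' a₀ a₁, ZrOfRecord₁₃ F N (theta13OfThm1CCMW F N j γ ε₀ ε₂₉ B₃ B₃' a₀ a₁)⟩) (N24_provisos₁₃SepCoPH_door_theta13OfThm1CCMW_of_gauge9TopStepR_of_betaBoxSignFree_allTorus hγ₀ hγh hε hε' hB hB' ha₀ ha₁ h15 hc h9 hbox hbox' hl hβ')).C →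
      w.γ ≤ γ₉ → ∀ P : B12.RunParams, (leavesP w P).smallCouplings → (leavesP w P).smallFieldInductive)
    (h10 : ∃ lam13 : B12.RunParams → ResidB13 (theta13OfThm1CCMW F N j γ ε₀ ε₂₉ B₃ B₃' a₀ a₁).toStage3Params,
      ∀ P : B12.RunParams, B13LeafOfRecord (theta13OfThm1CCMW F N j γ ε₀ ε₂₉ B₃ B₃' a₀ a₁).toStage3Params (lam13 P))
    (h11 : ∀ βup β₀ : ℝ, ∃ γ₁₁ : ℝ, 0 < γ₁₁ ∧ ∀ w : WorldP, w.C = (datumOfRecord₁₃SepCoPH F N (Stage13HParams.ofHistoryBlind F N ⟨theta13OfThm1CCMW F N j γ ε₀ ε₂₉ B₃ B₃' a₀ a₁, ZrOfRecord₁₃ F N (theta13OfThm1CCMW F N j γ ε₀ ε₂₉ B₃ B₃' a₀ a₁)⟩) (N24_provisos₁₃SepCoPH_door_theta13OfThm1CCMW_of_gauge9TopStepR_of_betaBoxSignFree_allTorus hγ₀ hγh hε hε' hB hB' ha₀ ha₁ h15 hc h9 hbox hbox' hl hβ')).C →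
      w.βup = βup → w.β₀ = β₀ → w.γ ≤ γ₁₁ → ∀ P : B12.RunParams, (leavesP w P).b7 → (leavesP w P).b8 → (leavesP w P).b9 → (leavesP w P).b10 → (leavesP w P).b11 →
      (leavesP w P).smallCouplings → (leavesP w P).smallFieldInductive → (leavesP w P).flowControl →
        ∀ k, k < P.K → SLaw₁₃CoPH F N (Stage13HParams.ofHistoryBlind F N ⟨theta13OfThm1CCMW F N j γ ε₀ ε₂₉ B₃ B₃' a₀ a₁, ZrOfRecord₁₃ F N (theta13OfThm1CCMW F N j γ ε₀ ε₂₉ B₃ B₃' a₀ a₁)⟩) P k → TLaw₁₃CoPH F N (Stage13HParams.ofHistoryBlind F N ⟨theta13OfThm1CCMW F N j γ ε₀ ε₂₉ B₃ B₃' a₀ a₁, ZrOfRecord₁₃ F N (theta13OfThm1CCMW F N j γ ε₀ ε₂₉ B₃ B₃' a₀ a₁)⟩) P k)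
    (h12 : ∃ lamW : ResidW F N, (∀ P : B12.RunParams, B15Leaf (WOfRecord₁₃ F N (theta13OfThm1CCMW F N j γ ε₀ ε₂₉ B₃ B₃' a₀ a₁) lamW P)) ∧
      ∀ P : B12.RunParams, 1 ≤ P.K → lamW.kSel P < P.K)
    (hUV : ∃ γ₁₃ : ℝ, 0 < γ₁₃ ∧ ∃ em ep : ℝ → ℝ, ∀ P : B12.RunParams, (genFlow (betaOfRecord₁₃ F N (theta13OfThm1CCMW F N j γ ε₀ ε₂₉ B₃ B₃' a₀ a₁)) P.g0).InInterval γ₁₃ P.K → ∀ k, k ≤ P.K → SLaw₁₃CoPH F N (Stage13HParams.ofHistoryBlind F N ⟨theta13OfThm1CCMW F N j γ ε₀ ε₂₉ B₃ B₃' a₀ a₁, ZrOfRecord₁₃ F N (theta13OfThm1CCMW F N j γ ε₀ ε₂₉ B₃ B₃' a₀ a₁)⟩) P k →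
      ∀ U : GaugeField (F.P P.K) k (SU N),
        chiβOfRecord₁₃ F N (theta13OfThm1CCMW F N j γ ε₀ ε₂₉ B₃ B₃' a₀ a₁) P.K (gOfRecord₁₃ F N (theta13OfThm1CCMW F N j γ ε₀ ε₂₉ B₃ B₃' a₀ a₁) P) k U *
              Real.exp (-(1 / (gOfRecord₁₃ F N (theta13OfThm1CCMW F N j γ ε₀ ε₂₉ B₃ B₃' a₀ a₁) P k) ^ 2 * wilsonBGOfRecord F N (theta13OfThm1CCMW F N j γ ε₀ ε₂₉ B₃ B₃' a₀ a₁).εbg P k U)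
                - em (gOfRecord₁₃ F N (theta13OfThm1CCMW F N j γ ε₀ ε₂₉ B₃ B₃' a₀ a₁) P k) * (Fintype.card (Site (F.P P.K) k) : ℝ)) ≤ densOfRecord₁₃ F N (theta13OfThm1CCMW F N j γ ε₀ ε₂₉ B₃ B₃' a₀ a₁) P k U ∧
        densOfRecord₁₃ F N (theta13OfThm1CCMW F N j γ ε₀ ε₂₉ B₃ B₃' a₀ a₁) P k U ≤ Real.exp (ep (gOfRecord₁₃ F N (theta13OfThm1CCMW F N j γ ε₀ ε₂₉ B₃ B₃' a₀ a₁) P k) * (Fintype.card (Site (F.P P.K) k) : ℝ)))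
    {b : ℕ → ℝ} {r γR B M : ℝ} (hγR : 0 < γR)
    (hrem : RunConstRemainder (betaOfRecord₁₃ F N (theta13OfThm1CCMW F N j γ ε₀ ε₂₉ B₃ B₃' a₀ a₁)) b r γR) (hbB : ∀ k, b k ≤ B)
    (hps : ∀ (n : ℕ) (gs : ℕ → ℝ), RGEqH n (betaOfRecord₁₃ F N (theta13OfThm1CCMW F N j γ ε₀ ε₂₉ B₃ B₃' a₀ a₁)) gs → Step.InInterval γR n gs →
      ∀ k, k ≤ n → -M ≤ ∑ i ∈ Finset.Ico k n, betaOfRecord₁₃ F N (theta13OfThm1CCMW F N j γ ε₀ ε₂₉ B₃ B₃' a₀ a₁) i (prefixOf gs i)) :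
    ∃ (θ' : Stage13HParams F N) (h' : θ'.Provisos₁₃SepCoPH F N), (θ'.ZhUnity F N ∧ θ'.SlotsNondegenerate₁₃ F N) ∧ θ'.Admissible F N ∧
      B16.EndStatementBPrinted (datumOfRecord₁₃SepCoPH F N θ' h').C ∧
      ∃ γ₁ : ℝ, 0 < γ₁ ∧ ∀ γ : ℝ, 0 < γ → γ ≤ γ₁ → ∃ P : B12.RunParams, 1 ≤ P.K ∧ ((datumOfRecord₁₃SepCoPH F N θ' h').C P).flow.InInterval γ P.K := by
  obtain ⟨lam8, h05⟩ := h05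
  obtain ⟨Mstar, ops, h06⟩ := h06
  obtain ⟨ζ, h07⟩ := h07
  obtain ⟨lam12, h09⟩ := h09
  obtain ⟨lam13, h10⟩ := h10
  obtain ⟨γ₉, hγ₉, h09T⟩ := h09T
  obtain ⟨γ₁₁, hγ₁₁, h11⟩ := h11 (B + r) 1
  obtain ⟨lamW, h12, -⟩ := h12
  obtain ⟨γ₁₃, hγ₁₃, em, ep, hUV⟩ := hUV
  have hL1 : (1 : ℝ) < ((theta13OfThm1CCMW F N j γ ε₀ ε₂₉ B₃ B₃' a₀ a₁).L : ℝ) := by exact_mod_cast F.hL.2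
  have hγw0 : 0 < min γ (min γ₉ (min γ₁₁ γ₁₃)) := lt_min hγ₀ (lt_min hγ₉ (lt_min hγ₁₁ hγ₁₃))
  have hγwγ : min γ (min γ₉ (min γ₁₁ γ₁₃)) ≤ γ := min_le_left _ _
  have hγw9 : min γ (min γ₉ (min γ₁₁ γ₁₃)) ≤ γ₉ := (min_le_right _ _).trans (min_le_left _ _)
  have hγw11 : min γ (min γ₉ (min γ₁₁ γ₁₃)) ≤ γ₁₁ := (min_le_right _ _).trans ((min_le_right _ _).trans (min_le_left _ _))
  have hγw13 : min γ (min γ₉ (min γ₁₁ γ₁₃)) ≤ γ₁₃ := (min_le_right _ _).trans ((min_le_right _ _).trans (min_le_right _ _))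
  set γw : ℝ := min γ (min γ₉ (min γ₁₁ γ₁₃))
  let w : WorldP :=
    { C := (datumOfRecord₁₃SepCoPH F N (Stage13HParams.ofHistoryBlind F N ⟨theta13OfThm1CCMW F N j γ ε₀ ε₂₉ B₃ B₃' a₀ a₁, ZrOfRecord₁₃ F N (theta13OfThm1CCMW F N j γ ε₀ ε₂₉ B₃ B₃' a₀ a₁)⟩) (N24_provisos₁₃SepCoPH_door_theta13OfThm1CCMW_of_gauge9TopStepR_of_betaBoxSignFree_allTorus hγ₀ hγh hε hε' hB hB' ha₀ ha₁ h15 hc h9 hbox hbox' hl hβ')).C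
      γ := γw, em := em, ep := ep, βup := B + r, β₀ := 1, β₀_pos := one_pos, b := 1, b_pos := one_pos
      L := ((theta13OfThm1CCMW F N j γ ε₀ ε₂₉ B₃ B₃' a₀ a₁).L : ℝ), one_lt_L := hL1, gR := 0
      up := upOfRecord₅CS F N (((Stage13HParams.ofHistoryBlind F N ⟨theta13OfThm1CCMW F N j γ ε₀ ε₂₉ B₃ B₃' a₀ a₁, ZrOfRecord₁₃ F N (theta13OfThm1CCMW F N j γ ε₀ ε₂₉ B₃ B₃' a₀ a₁)⟩).rebindX F N (fun P : B12.RunParams => (((((theta13OfThm1CCMW F N j γ ε₀ ε₂₉ B₃ B₃' a₀ a₁).res.X P).withB8OfRecordSubBP (theta13OfThm1CCMW F N j γ ε₀ ε₂₉ B₃ B₃' a₀ a₁).toStage3Params lam8).withB12 (F12OfRecord₁₂ F N (theta13OfThm1CCMW F N j γ ε₀ ε₂₉ B₃ B₃' a₀ a₁).toStage12Params lam12 P) (lam12 P).consts).withB13OfRecord (theta13OfThm1CCMW F N j γ ε₀ ε₂₉ B₃ B₃' a₀ a₁).toStage3Params (lam13 P)))).view₁₃CoPHB10YZW F N Mstar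 ops ζ lamW) }
  have hC : w.C = (datumOfRecord₁₃SepCoPH F N (Stage13HParams.ofHistoryBlind F N ⟨theta13OfThm1CCMW F N j γ ε₀ ε₂₉ B₃ B₃' a₀ a₁, ZrOfRecord₁₃ F N (theta13OfThm1CCMW F N j γ ε₀ ε₂₉ B₃ B₃' a₀ a₁)⟩) (N24_provisos₁₃SepCoPH_door_theta13OfThm1CCMW_of_gauge9TopStepR_of_betaBoxSignFree_allTorus hγ₀ hγh hε hε' hB hB' ha₀ ha₁ h15 hc h9 hbox hbox' hl hβ')).C := rfl
  have hθ := admissible_theta13OfThm1CCMW_of_le_half F N hγ₀ hγh hε hε' hB hB' ha₀ ha₁ (j := j) (ε₀ := ε₀) (ε₂₉ := ε₂₉)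
  have hU : (Stage13HParams.ofHistoryBlind F N ⟨theta13OfThm1CCMW F N j γ ε₀ ε₂₉ B₃ B₃' a₀ a₁, ZrOfRecord₁₃ F N (theta13OfThm1CCMW F N j γ ε₀ ε₂₉ B₃ B₃' a₀ a₁)⟩).ZhUnity F N ∧ (Stage13HParams.ofHistoryBlind F N ⟨theta13OfThm1CCMW F N j γ ε₀ ε₂₉ B₃ B₃' a₀ a₁, ZrOfRecord₁₃ F N (theta13OfThm1CCMW F N j γ ε₀ ε₂₉ B₃ B₃' a₀ a₁)⟩).SlotsNondegenerate₁₃ F N :=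
    ⟨(Stage13RParams.ZrUnity.ofHistoryBlind (θ := ⟨theta13OfThm1CCMW F N j γ ε₀ ε₂₉ B₃ B₃' a₀ a₁, ZrOfRecord₁₃ F N (theta13OfThm1CCMW F N j γ ε₀ ε₂₉ B₃ B₃' a₀ a₁)⟩)
      fun p i ω => finsum_ζ0_ZrOfRecord₁₃ (θ := theta13OfThm1CCMW F N j γ ε₀ ε₂₉ B₃ B₃' a₀ a₁) (p := p) i ω),
     slotsNondegenerate₁₃_theta13OfThm1CCMW F N j γ ε₀ ε₂₉ B₃ B₃' a₀ a₁⟩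
  have hlaws : ∀ (P : B12.RunParams) (k : ℕ), k < P.K → TLaw₁₃CoPH F N (Stage13HParams.ofHistoryBlind F N ⟨theta13OfThm1CCMW F N j γ ε₀ ε₂₉ B₃ B₃' a₀ a₁, ZrOfRecord₁₃ F N (theta13OfThm1CCMW F N j γ ε₀ ε₂₉ B₃ B₃' a₀ a₁)⟩) P k → SLaw₁₃CoPH F N (Stage13HParams.ofHistoryBlind F N ⟨theta13OfThm1CCMW F N j γ ε₀ ε₂₉ B₃ B₃' a₀ a₁, ZrOfRecord₁₃ F N (theta13OfThm1CCMW F N j γ ε₀ ε₂₉ B₃ B₃' a₀ a₁)⟩) P (k + 1) := fun P =>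
    N24_laws₁₃CoPH_theta13OfThm1CCMW (ZrOfRecord₁₃ F N (theta13OfThm1CCMW F N j γ ε₀ ε₂₉ B₃ B₃' a₀ a₁)) (fun p _ _ _ => ZrOfRecord₁₃ F N (theta13OfThm1CCMW F N j γ ε₀ ε₂₉ B₃ B₃' a₀ a₁) p) (fun p _ _ _ => ((theta13OfThm1CCMW F N j γ ε₀ ε₂₉ B₃ B₃' a₀ a₁).Rz p.K).phi) P hγ₀ hγh hε hε' hB hB' ha₀ ha₁
  have hUVw : ∀ P : B12.RunParams, (genFlow (betaOfRecord₁₃ F N (Stage13HParams.ofHistoryBlind F N ⟨theta13OfThm1CCMW F N j γ ε₀ ε₂₉ B₃ B₃' a₀ a₁, ZrOfRecord₁₃ F N (theta13OfThm1CCMW F N j γ ε₀ ε₂₉ B₃ B₃' a₀ a₁)⟩).toStage13Params) P.g0).InInterval w.γ P.K → ∀ k, k ≤ P.K → SLaw₁₃CoPH F N (Stage13HParams.ofHistoryBlind F N ⟨theta13OfThm1CCMW F N j γ ε₀ ε₂₉ B₃ B₃' a₀ a₁, ZrOfRecord₁₃ F N (theta13OfThm1CCMW F N j γ ε₀ ε₂₉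 B₃ B₃' a₀ a₁)⟩) P k →
      ∀ U : GaugeField (F.P P.K) k (SU N),
        chiβOfRecord₁₃ F N (Stage13HParams.ofHistoryBlind F N ⟨theta13OfThm1CCMW F N j γ ε₀ ε₂₉ B₃ B₃' a₀ a₁, ZrOfRecord₁₃ F N (theta13OfThm1CCMW F N j γ ε₀ ε₂₉ B₃ B₃' a₀ a₁)⟩).toStage13Params P.K (gOfRecord₁₃ F N (Stage13HParams.ofHistoryBlind F N ⟨theta13OfThm1CCMW F N j γ ε₀ ε₂₉ B₃ B₃' a₀ a₁, ZrOfRecord₁₃ F N (theta13OfThm1CCMW F N j γ ε₀ ε₂₉ B₃ B₃' a₀ a₁)⟩).toStage13Params P) k U *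
              Real.exp (-(1 / (gOfRecord₁₃ F N (Stage13HParams.ofHistoryBlind F N ⟨theta13OfThm1CCMW F N j γ ε₀ ε₂₉ B₃ B₃' a₀ a₁, ZrOfRecord₁₃ F N (theta13OfThm1CCMW F N j γ ε₀ ε₂₉ B₃ B₃' a₀ a₁)⟩).toStage13Params P k) ^ 2 * wilsonBGOfRecord F N (Stage13HParams.ofHistoryBlind F N ⟨theta13OfThm1CCMW F N j γ ε₀ ε₂₉ B₃ B₃' a₀ a₁, ZrOfRecord₁₃ F N (theta13OfThm1CCMW F N j γ ε₀ ε₂₉ B₃ B₃' a₀ a₁)⟩).εbg P k U)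
                - w.em (gOfRecord₁₃ F N (Stage13HParams.ofHistoryBlind F N ⟨theta13OfThm1CCMW F N j γ ε₀ ε₂₉ B₃ B₃' a₀ a₁, ZrOfRecord₁₃ F N (theta13OfThm1CCMW F N j γ ε₀ ε₂₉ B₃ B₃' a₀ a₁)⟩).toStage13Params P k) * (Fintype.card (Site (F.P P.K) k) : ℝ)) ≤ densOfRecord₁₃ F N (Stage13HParams.ofHistoryBlind F N ⟨theta13OfThm1CCMW F N j γ ε₀ ε₂₉ B₃ B₃' a₀ a₁, ZrOfRecord₁₃ F N (theta13OfThm1CCMW F N j γ ε₀ ε₂₉ B₃ B₃' a₀ a₁)⟩).toStage13Params P k U ∧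
        densOfRecord₁₃ F N (Stage13HParams.ofHistoryBlind F N ⟨theta13OfThm1CCMW F N j γ ε₀ ε₂₉ B₃ B₃' a₀ a₁, ZrOfRecord₁₃ F N (theta13OfThm1CCMW F N j γ ε₀ ε₂₉ B₃ B₃' a₀ a₁)⟩).toStage13Params P k U ≤ Real.exp (w.ep (gOfRecord₁₃ F N (Stage13HParams.ofHistoryBlind F N ⟨theta13OfThm1CCMW F N j γ ε₀ ε₂₉ B₃ B₃' a₀ a₁, ZrOfRecord₁₃ F N (theta13OfThm1CCMW F N j γ ε₀ ε₂₉ B₃ B₃' a₀ a₁)⟩).toStage13Params P k) * (Fintype.card (Site (F.P P.K) k) : ℝ)) :=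
    fun P hI k hk hS U => hUV P (B14Cor3.inInterval_of_le hI hγw13) k hk hS U
  have hR := N24_recordS₁₃SepCoPH_of_upS_rebindX_view (Stage13HParams.ofHistoryBlind F N ⟨theta13OfThm1CCMW F N j γ ε₀ ε₂₉ B₃ B₃' a₀ a₁, ZrOfRecord₁₃ F N (theta13OfThm1CCMW F N j γ ε₀ ε₂₉ B₃ B₃' a₀ a₁)⟩) (N24_provisos₁₃SepCoPH_door_theta13OfThm1CCMW_of_gauge9TopStepR_of_betaBoxSignFree_allTorus hγ₀ hγh hε hε' hB hB' ha₀ ha₁ h15 hc h9 hbox hbox' hl hβ') hθ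
    (fun P : B12.RunParams => (((((theta13OfThm1CCMW F N j γ ε₀ ε₂₉ B₃ B₃' a₀ a₁).res.X P).withB8OfRecordSubBP (theta13OfThm1CCMW F N j γ ε₀ ε₂₉ B₃ B₃' a₀ a₁).toStage3Params lam8).withB12 (F12OfRecord₁₂ F N (theta13OfThm1CCMW F N j γ ε₀ ε₂₉ B₃ B₃' a₀ a₁).toStage12Params lam12 P) (lam12 P).consts).withB13OfRecord (theta13OfThm1CCMW F N j γ ε₀ ε₂₉ B₃ B₃' a₀ a₁).toStage3Params (lam13 P))) Mstar ops ζ lamW w hC ⟨hγw0, hγwγ⟩ rfl (fun P => rfl)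
  have hnodes := N24_nodes₁₃CoPH_rebindXS_fourPin_pointed (Stage13HParams.ofHistoryBlind F N ⟨theta13OfThm1CCMW F N j γ ε₀ ε₂₉ B₃ B₃' a₀ a₁, ZrOfRecord₁₃ F N (theta13OfThm1CCMW F N j γ ε₀ ε₂₉ B₃ B₃' a₀ a₁)⟩) (N24_provisos₁₃SepCoPH_door_theta13OfThm1CCMW_of_gauge9TopStepR_of_betaBoxSignFree_allTorus hγ₀ hγh hε hε' hB hB' ha₀ ha₁ h15 hc h9 hbox hbox' hl hβ').toCore hθ
    (fun P : B12.RunParams => (((((theta13OfThm1CCMW F N j γ ε₀ ε₂₉ B₃ B₃' a₀ a₁).res.X P).withB8OfRecordSubBP (theta13OfThm1CCMW F N j γ ε₀ ε₂₉ B₃ B₃' a₀ a₁).toStage3Params lam8).withB12 (F12OfRecord₁₂ F N (theta13OfThm1CCMW F N j γ ε₀ ε₂₉ B₃ B₃' a₀ a₁).toStage12Params lam12 P) (lam12 P).consts).withB13OfRecord (theta13OfThm1CCMW F N j γ ε₀ ε₂₉ B₃ B₃' a₀ a₁).toStage3Params (lam13 P))) Mstar ops ζ lamW w hC ⟨hγw0,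 hγwγ⟩ rfl (fun P => rfl)
    (fun P => h05) h06 h07 h08 (fun P => h09 P) (h09T w hC hγw9) (fun P _ _ _ _ => h10 P) (h11 w hC rfl rfl hγw11) h12 hlaws hUVw
  obtain ⟨hU', hθ', hEnd, hwin⟩ := stabilityB_body_of_rung1At_of_runLetters _ _ w hU hθ hR hnodes hγR hrem hbB le_rfl hps
  exact ⟨_, _, hU', hθ', hEnd, hwin⟩

/-- **★★ K1⁷ v6's RUNG-2″ BODY (`RunRowsAtSomeRecord13PWS`'s text with `RecordS` unfolded, general `N`) AT THE WITNESS, door letters fixed, FROM THE TEN WORLD-FREE CHILDREN HYPOTHESES (N05 ON THE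
P-SLOT) AND THE RUN ROWS — the rung-1 data `(θ₁₅ᶜᶜᴹᵂ-door, w)` with the thirteen nodes AND the rows with the ceiling match DISCHARGED (`w.βup := B + r`)**.  This is the text plan g82's v6 stub
2″ `stub_runRows13PWS` must produce (its registered form takes rung 1's `∃`-datum and may re-choose the witness; this pointed form re-chooses it as the door over the K0 witness with N24's
world), so v6's composition `StabilityBAtRecordR13SepCoPH_ofRunRows` is fed BY NAME once the children and the rows are theorems.  PROOF as in §1, then the anonymous constructor.
COMPOSITE and CONDITIONAL: every hypothesis displayed; nothing of Bałaban asserted; K0⁷ ∕ K1⁷ NOT closed; no stub closed; no count moved. [cite: Balaban1989LargeFieldII, Thm 1 p.355, (0.1) pp.355–356, p.391; Balaban1988Convergent, Thm 1 p.262, Cor. 3 (2.50) p.264, (2.6) p.255, (3.16)–(3.23) pp.268–270; Balaban1987RG1, Thm 1 p.255, Thm 2 p.259, Thm 3 p.264, Lemma 4 p.280, (0.17)–(0.20) pp.255–256, (1.20)–(1.22) p.264, (5.10) p.293; Balaban1988RG2Cluster, (2.41) p.21, Lemmas 1–3 pp.9–20; Balaban1985Variational, Thm 1 (8)–(9) p.279,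 Prop. 8 p.304; Balaban1985RegularSpaces, Lemma 1 p.79 – Thm 8 p.101, Prop. 6 p.99; Balaban1985UV3, Thm 1 p.257; Balaban1989LargeFieldI, Prop. 1 p.194 (bookkeeping)] -/
theorem N24_runRowsAtSomeRecordS₁₃SepCoPH_worldBuilt_childrenSplit_theta13OfThm1CCMW_of_gauge9TopStepR_of_betaBoxSignFree_allTorus_door {j c : ℕ} {γ ε₀ ε₂₉ B₃ B₃' a₀ a₁ : ℝ} (hγ₀ : 0 < γ) (hγh : γ ≤ 1 / 2)
    (hε : 0 < ε₀) (hε' : 0 < ε₂₉) (hB : 0 ≤ B₃) (hB' : 0 ≤ B₃') (ha₀ : 0 < a₀) (ha₁ : 0 < a₁)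
    (h15 : VariationalThm1RegSepCoP7M F N B₃ a₀ a₁) (hc : c ≤ F.L ^ j)
    (h9 : Gauge9RegSepTopStepR F N (fun ν K Ω => suppDomOfRecord F ν K Ω) (F.L ^ j) c B₃ B₃' a₀ a₁)
    {bl β' : ℝ} (hbox : BetaLowerH bl γ (betaOfRecord₁₃ F N (theta13OfThm1CCMW F N j γ ε₀ ε₂₉ B₃ B₃' a₀ a₁)))
    (hbox' : BetaUpperH β' γ (betaOfRecord₁₃ F N (theta13OfThm1CCMW F N j γ ε₀ ε₂₉ B₃ B₃' a₀ a₁))) (hl : -bl * γ ^ 2 ≤ 3) (hβ' : β' * γ ^ 2 ≤ 3 / 4)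
    (h05 : ∃ lam8 : ResidB8 (theta13OfThm1CCMW F N j γ ε₀ ε₂₉ B₃ B₃' a₀ a₁).toStage3Params, B8LeafOfRecordSubBP (theta13OfThm1CCMW F N j γ ε₀ ε₂₉ B₃ B₃' a₀ a₁).toStage3Params lam8)
    (h06 : ∃ (Mstar : ℕ) (ops : OpsY N (theta13OfThm1CCMW F N j γ ε₀ ε₂₉ B₃ B₃' a₀ a₁).toStage3Params Mstar), B9LeafX (Y9OfRecord N (theta13OfThm1CCMW F N j γ ε₀ ε₂₉ B₃ B₃' a₀ a₁).toStage3Params Mstar ops))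
    (h07 : ∃ ζ : ResidZ F N, B11Leaf (Z11OfRecord F N ζ))
    (h08 : PrintedUV3V N F.L)
    (h09 : ∃ lam12 : ResidB12 F N (theta13OfThm1CCMW F N j γ ε₀ ε₂₉ B₃ B₃' a₀ a₁).τ9.M,
      ∀ P : B12.RunParams, B12Sec2to5.Lemma4Printed (F12OfRecord₁₂ F N (theta13OfThm1CCMW F N j γ ε₀ ε₂₉ B₃ B₃' a₀ a₁).toStage12Params lam12 P) (lam12 P).consts)
    (h09T : ∃ γ₉ : ℝ, 0 < γ₉ ∧ ∀ w : WorldP, w.C = (datumOfRecord₁₃SepCoPH F N (Stage13HParams.ofHistoryBlind F N ⟨theta13OfThm1CCMW F N j γ ε₀ ε₂₉ B₃ B₃' a₀ a₁, ZrOfRecord₁₃ F N (theta13OfThm1CCMW F N j γ ε₀ ε₂₉ B₃ B₃' a₀ a₁)⟩) (N24_provisos₁₃SepCoPH_door_theta13OfThm1CCMW_of_gauge9TopStepR_of_betaBoxSignFree_allTorus hγ₀ hγh hε hε' hB hB' ha₀ ha₁ h15 hc h9 hbox hbox' hl hβ')).C →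
      w.γ ≤ γ₉ → ∀ P : B12.RunParams, (leavesP w P).smallCouplings → (leavesP w P).smallFieldInductive)
    (h10 : ∃ lam13 : B12.RunParams → ResidB13 (theta13OfThm1CCMW F N j γ ε₀ ε₂₉ B₃ B₃' a₀ a₁).toStage3Params,
      ∀ P : B12.RunParams, B13LeafOfRecord (theta13OfThm1CCMW F N j γ ε₀ ε₂₉ B₃ B₃' a₀ a₁).toStage3Params (lam13 P))
    (h11 : ∀ βup β₀ : ℝ, ∃ γ₁₁ : ℝ, 0 < γ₁₁ ∧ ∀ w : WorldP, w.C = (datumOfRecord₁₃SepCoPH F N (Stage13HParams.ofHistoryBlind F N ⟨theta13OfThm1CCMW F N j γ ε₀ ε₂₉ B₃ B₃' a₀ a₁, ZrOfRecord₁₃ F N (theta13OfThm1CCMW F N j γ ε₀ ε₂₉ B₃ B₃' a₀ a₁)⟩) (N24_provisos₁₃SepCoPH_door_theta13OfThm1CCMW_of_gauge9TopStepR_of_betaBoxSignFree_allTorus hγ₀ hγh hε hε' hB hB' ha₀ ha₁ h15 hc h9 hbox hbox' hl hβ')).C →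
      w.βup = βup → w.β₀ = β₀ → w.γ ≤ γ₁₁ → ∀ P : B12.RunParams, (leavesP w P).b7 → (leavesP w P).b8 → (leavesP w P).b9 → (leavesP w P).b10 → (leavesP w P).b11 →
      (leavesP w P).smallCouplings → (leavesP w P).smallFieldInductive → (leavesP w P).flowControl →
        ∀ k, k < P.K → SLaw₁₃CoPH F N (Stage13HParams.ofHistoryBlind F N ⟨theta13OfThm1CCMW F N j γ ε₀ ε₂₉ B₃ B₃' a₀ a₁, ZrOfRecord₁₃ F N (theta13OfThm1CCMW F N j γ ε₀ ε₂₉ B₃ B₃' a₀ a₁)⟩) P k → TLaw₁₃CoPH F N (Stage13HParams.ofHistoryBlind F N ⟨theta13OfThm1CCMW F N j γ ε₀ ε₂₉ B₃ B₃' a₀ a₁, ZrOfRecord₁₃ F N (theta13OfThm1CCMW F N j γ ε₀ ε₂₉ B₃ B₃' a₀ a₁)⟩) P k)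
    (h12 : ∃ lamW : ResidW F N, (∀ P : B12.RunParams, B15Leaf (WOfRecord₁₃ F N (theta13OfThm1CCMW F N j γ ε₀ ε₂₉ B₃ B₃' a₀ a₁) lamW P)) ∧
      ∀ P : B12.RunParams, 1 ≤ P.K → lamW.kSel P < P.K)
    (hUV : ∃ γ₁₃ : ℝ, 0 < γ₁₃ ∧ ∃ em ep : ℝ → ℝ, ∀ P : B12.RunParams, (genFlow (betaOfRecord₁₃ F N (theta13OfThm1CCMW F N j γ ε₀ ε₂₉ B₃ B₃' a₀ a₁)) P.g0).InInterval γ₁₃ P.K → ∀ k, k ≤ P.K → SLaw₁₃CoPH F N (Stage13HParams.ofHistoryBlind F N ⟨theta13OfThm1CCMW F N j γ ε₀ ε₂₉ B₃ B₃' a₀ a₁, ZrOfRecord₁₃ F N (theta13OfThm1CCMW F N j γ ε₀ ε₂₉ B₃ B₃' a₀ a₁)⟩) P k →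
      ∀ U : GaugeField (F.P P.K) k (SU N),
        chiβOfRecord₁₃ F N (theta13OfThm1CCMW F N j γ ε₀ ε₂₉ B₃ B₃' a₀ a₁) P.K (gOfRecord₁₃ F N (theta13OfThm1CCMW F N j γ ε₀ ε₂₉ B₃ B₃' a₀ a₁) P) k U *
              Real.exp (-(1 / (gOfRecord₁₃ F N (theta13OfThm1CCMW F N j γ ε₀ ε₂₉ B₃ B₃' a₀ a₁) P k) ^ 2 * wilsonBGOfRecord F N (theta13OfThm1CCMW F N j γ ε₀ ε₂₉ B₃ B₃' a₀ a₁).εbg P k U)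
                - em (gOfRecord₁₃ F N (theta13OfThm1CCMW F N j γ ε₀ ε₂₉ B₃ B₃' a₀ a₁) P k) * (Fintype.card (Site (F.P P.K) k) : ℝ)) ≤ densOfRecord₁₃ F N (theta13OfThm1CCMW F N j γ ε₀ ε₂₉ B₃ B₃' a₀ a₁) P k U ∧
        densOfRecord₁₃ F N (theta13OfThm1CCMW F N j γ ε₀ ε₂₉ B₃ B₃' a₀ a₁) P k U ≤ Real.exp (ep (gOfRecord₁₃ F N (theta13OfThm1CCMW F N j γ ε₀ ε₂₉ B₃ B₃' a₀ a₁) P k) * (Fintype.card (Site (F.P P.K) k) : ℝ)))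
    {b : ℕ → ℝ} {r γR B M : ℝ} (hγR : 0 < γR)
    (hrem : RunConstRemainder (betaOfRecord₁₃ F N (theta13OfThm1CCMW F N j γ ε₀ ε₂₉ B₃ B₃' a₀ a₁)) b r γR) (hbB : ∀ k, b k ≤ B)
    (hps : ∀ (n : ℕ) (gs : ℕ → ℝ), RGEqH n (betaOfRecord₁₃ F N (theta13OfThm1CCMW F N j γ ε₀ ε₂₉ B₃ B₃' a₀ a₁)) gs → Step.InInterval γR n gs →
      ∀ k, k ≤ n → -M ≤ ∑ i ∈ Finset.Ico k n, betaOfRecord₁₃ F N (theta13OfThm1CCMW F N j γ ε₀ ε₂₉ B₃ B₃' a₀ a₁) i (prefixOf gs i)) :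
    ∃ (θ : Stage13HParams F N) (hP : θ.Provisos₁₃SepCoPH F N) (w : WorldP), (θ.ZhUnity F N ∧ θ.SlotsNondegenerate₁₃ F N) ∧ θ.Admissible F N ∧
      (∃ (θ' : Stage13HParams F N) (h' : θ'.Provisos₁₃SepCoPH F N), θ'.Admissible F N ∧
      datumOfRecord₁₃SepCoPH F N θ hP = datumOfRecord₁₃SepCoPH F N θ' h' ∧ w.C = (datumOfRecord₁₃SepCoPH F N θ hP).C ∧ (0 < w.γ ∧ w.γ ≤ θ'.γ) ∧
      w.L = (θ'.L : ℝ) ∧ ∀ P : B12.RunParams, w.up P = upOfRecord₅CS F N (θ'.toStage5₁₃CoPH F N) P) ∧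
      (∀ P : B12.RunParams, Nodes (leavesP w P)) ∧
      ∃ (b : ℕ → ℝ) (r γ₀ B M : ℝ), 0 < γ₀ ∧ RunConstRemainder (betaOfRecord₁₃ F N θ.toStage13Params) b r γ₀ ∧ (∀ k, b k ≤ B) ∧ B + r ≤ w.βup ∧
        ∀ (n : ℕ) (gs : ℕ → ℝ), RGEqH n (betaOfRecord₁₃ F N θ.toStage13Params) gs → Step.InInterval γ₀ n gs →
          ∀ k, k ≤ n → -M ≤ ∑ j ∈ Finset.Ico k n, betaOfRecord₁₃ F N θ.toStage13Params j (prefixOf gs j) := by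
  obtain ⟨lam8, h05⟩ := h05
  obtain ⟨Mstar, ops, h06⟩ := h06
  obtain ⟨ζ, h07⟩ := h07
  obtain ⟨lam12, h09⟩ := h09
  obtain ⟨lam13, h10⟩ := h10
  obtain ⟨γ₉, hγ₉, h09T⟩ := h09T
  obtain ⟨γ₁₁, hγ₁₁, h11⟩ := h11 (B + r) 1
  obtain ⟨lamW, h12, -⟩ := h12
  obtain ⟨γ₁₃, hγ₁₃, em, ep, hUV⟩ := hUV
  have hL1 : (1 : ℝ) < ((theta13OfThm1CCMW F N j γ ε₀ ε₂₉ B₃ B₃' a₀ a₁).L : ℝ) := by exact_mod_cast F.hL.2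
  have hγw0 : 0 < min γ (min γ₉ (min γ₁₁ γ₁₃)) := lt_min hγ₀ (lt_min hγ₉ (lt_min hγ₁₁ hγ₁₃))
  have hγwγ : min γ (min γ₉ (min γ₁₁ γ₁₃)) ≤ γ := min_le_left _ _
  have hγw9 : min γ (min γ₉ (min γ₁₁ γ₁₃)) ≤ γ₉ := (min_le_right _ _).trans (min_le_left _ _)
  have hγw11 : min γ (min γ₉ (min γ₁₁ γ₁₃)) ≤ γ₁₁ := (min_le_right _ _).trans ((min_le_right _ _).trans (min_le_left _ _))
  have hγw13 : min γ (min γ₉ (min γ₁₁ γ₁₃)) ≤ γ₁₃ := (min_le_right _ _).trans ((min_le_right _ _).trans (min_le_right _ _))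
  set γw : ℝ := min γ (min γ₉ (min γ₁₁ γ₁₃))
  let w : WorldP :=
    { C := (datumOfRecord₁₃SepCoPH F N (Stage13HParams.ofHistoryBlind F N ⟨theta13OfThm1CCMW F N j γ ε₀ ε₂₉ B₃ B₃' a₀ a₁, ZrOfRecord₁₃ F N (theta13OfThm1CCMW F N j γ ε₀ ε₂₉ B₃ B₃' a₀ a₁)⟩) (N24_provisos₁₃SepCoPH_door_theta13OfThm1CCMW_of_gauge9TopStepR_of_betaBoxSignFree_allTorus hγ₀ hγh hε hε' hB hB' ha₀ ha₁ h15 hc h9 hbox hbox' hl hβ')).C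
      γ := γw, em := em, ep := ep, βup := B + r, β₀ := 1, β₀_pos := one_pos, b := 1, b_pos := one_pos
      L := ((theta13OfThm1CCMW F N j γ ε₀ ε₂₉ B₃ B₃' a₀ a₁).L : ℝ), one_lt_L := hL1, gR := 0
      up := upOfRecord₅CS F N (((Stage13HParams.ofHistoryBlind F N ⟨theta13OfThm1CCMW F N j γ ε₀ ε₂₉ B₃ B₃' a₀ a₁, ZrOfRecord₁₃ F N (theta13OfThm1CCMW F N j γ ε₀ ε₂₉ B₃ B₃' a₀ a₁)⟩).rebindX F N (fun P : B12.RunParams => (((((theta13OfThm1CCMW F N j γ ε₀ ε₂₉ B₃ B₃' a₀ a₁).res.X P).withB8OfRecordSubBP (theta13OfThm1CCMW F N j γ ε₀ ε₂₉ B₃ B₃' a₀ a₁).toStage3Params lam8).withB12 (F12OfRecord₁₂ F N (theta13OfThm1CCMW F N j γ ε₀ ε₂₉ B₃ B₃' a₀ a₁).toStage12Params lam12 P) (lam12 P).consts).withB13OfRecord (theta13OfThm1CCMW F N j γ ε₀ ε₂₉ B₃ B₃' a₀ a₁).toStage3Params (lam13 P)))).view₁₃CoPHB10YZW F N Mstar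 ops ζ lamW) }
  have hC : w.C = (datumOfRecord₁₃SepCoPH F N (Stage13HParams.ofHistoryBlind F N ⟨theta13OfThm1CCMW F N j γ ε₀ ε₂₉ B₃ B₃' a₀ a₁, ZrOfRecord₁₃ F N (theta13OfThm1CCMW F N j γ ε₀ ε₂₉ B₃ B₃' a₀ a₁)⟩) (N24_provisos₁₃SepCoPH_door_theta13OfThm1CCMW_of_gauge9TopStepR_of_betaBoxSignFree_allTorus hγ₀ hγh hε hε' hB hB' ha₀ ha₁ h15 hc h9 hbox hbox' hl hβ')).C := rfl
  have hθ := admissible_theta13OfThm1CCMW_of_le_half F N hγ₀ hγh hε hε' hB hB' ha₀ ha₁ (j := j) (ε₀ := ε₀) (ε₂₉ := ε₂₉)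
  have hU : (Stage13HParams.ofHistoryBlind F N ⟨theta13OfThm1CCMW F N j γ ε₀ ε₂₉ B₃ B₃' a₀ a₁, ZrOfRecord₁₃ F N (theta13OfThm1CCMW F N j γ ε₀ ε₂₉ B₃ B₃' a₀ a₁)⟩).ZhUnity F N ∧ (Stage13HParams.ofHistoryBlind F N ⟨theta13OfThm1CCMW F N j γ ε₀ ε₂₉ B₃ B₃' a₀ a₁, ZrOfRecord₁₃ F N (theta13OfThm1CCMW F N j γ ε₀ ε₂₉ B₃ B₃' a₀ a₁)⟩).SlotsNondegenerate₁₃ F N :=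
    ⟨(Stage13RParams.ZrUnity.ofHistoryBlind (θ := ⟨theta13OfThm1CCMW F N j γ ε₀ ε₂₉ B₃ B₃' a₀ a₁, ZrOfRecord₁₃ F N (theta13OfThm1CCMW F N j γ ε₀ ε₂₉ B₃ B₃' a₀ a₁)⟩)
      fun p i ω => finsum_ζ0_ZrOfRecord₁₃ (θ := theta13OfThm1CCMW F N j γ ε₀ ε₂₉ B₃ B₃' a₀ a₁) (p := p) i ω),
     slotsNondegenerate₁₃_theta13OfThm1CCMW F N j γ ε₀ ε₂₉ B₃ B₃' a₀ a₁⟩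
  have hlaws : ∀ (P : B12.RunParams) (k : ℕ), k < P.K → TLaw₁₃CoPH F N (Stage13HParams.ofHistoryBlind F N ⟨theta13OfThm1CCMW F N j γ ε₀ ε₂₉ B₃ B₃' a₀ a₁, ZrOfRecord₁₃ F N (theta13OfThm1CCMW F N j γ ε₀ ε₂₉ B₃ B₃' a₀ a₁)⟩) P k → SLaw₁₃CoPH F N (Stage13HParams.ofHistoryBlind F N ⟨theta13OfThm1CCMW F N j γ ε₀ ε₂₉ B₃ B₃' a₀ a₁, ZrOfRecord₁₃ F N (theta13OfThm1CCMW F N j γ ε₀ ε₂₉ B₃ B₃' a₀ a₁)⟩) P (k + 1) := fun P =>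
    N24_laws₁₃CoPH_theta13OfThm1CCMW (ZrOfRecord₁₃ F N (theta13OfThm1CCMW F N j γ ε₀ ε₂₉ B₃ B₃' a₀ a₁)) (fun p _ _ _ => ZrOfRecord₁₃ F N (theta13OfThm1CCMW F N j γ ε₀ ε₂₉ B₃ B₃' a₀ a₁) p) (fun p _ _ _ => ((theta13OfThm1CCMW F N j γ ε₀ ε₂₉ B₃ B₃' a₀ a₁).Rz p.K).phi) P hγ₀ hγh hε hε' hB hB' ha₀ ha₁
  have hUVw : ∀ P : B12.RunParams, (genFlow (betaOfRecord₁₃ F N (Stage13HParams.ofHistoryBlind F N ⟨theta13OfThm1CCMW F N j γ ε₀ ε₂₉ B₃ B₃' a₀ a₁, ZrOfRecord₁₃ F N (theta13OfThm1CCMW F N j γ ε₀ ε₂₉ B₃ B₃' a₀ a₁)⟩).toStage13Params) P.g0).InInterval w.γ P.K → ∀ k, k ≤ P.K → SLaw₁₃CoPH F N (Stage13HParams.ofHistoryBlind F N ⟨theta13OfThm1CCMW F N j γ ε₀ ε₂₉ B₃ B₃' a₀ a₁, ZrOfRecord₁₃ F N (theta13OfThm1CCMW F N j γ ε₀ ε₂₉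 B₃ B₃' a₀ a₁)⟩) P k →
      ∀ U : GaugeField (F.P P.K) k (SU N),
        chiβOfRecord₁₃ F N (Stage13HParams.ofHistoryBlind F N ⟨theta13OfThm1CCMW F N j γ ε₀ ε₂₉ B₃ B₃' a₀ a₁, ZrOfRecord₁₃ F N (theta13OfThm1CCMW F N j γ ε₀ ε₂₉ B₃ B₃' a₀ a₁)⟩).toStage13Params P.K (gOfRecord₁₃ F N (Stage13HParams.ofHistoryBlind F N ⟨theta13OfThm1CCMW F N j γ ε₀ ε₂₉ B₃ B₃' a₀ a₁, ZrOfRecord₁₃ F N (theta13OfThm1CCMW F N j γ ε₀ ε₂₉ B₃ B₃' a₀ a₁)⟩).toStage13Params P) k U *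
              Real.exp (-(1 / (gOfRecord₁₃ F N (Stage13HParams.ofHistoryBlind F N ⟨theta13OfThm1CCMW F N j γ ε₀ ε₂₉ B₃ B₃' a₀ a₁, ZrOfRecord₁₃ F N (theta13OfThm1CCMW F N j γ ε₀ ε₂₉ B₃ B₃' a₀ a₁)⟩).toStage13Params P k) ^ 2 * wilsonBGOfRecord F N (Stage13HParams.ofHistoryBlind F N ⟨theta13OfThm1CCMW F N j γ ε₀ ε₂₉ B₃ B₃' a₀ a₁, ZrOfRecord₁₃ F N (theta13OfThm1CCMW F N j γ ε₀ ε₂₉ B₃ B₃' a₀ a₁)⟩).εbg P k U)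
                - w.em (gOfRecord₁₃ F N (Stage13HParams.ofHistoryBlind F N ⟨theta13OfThm1CCMW F N j γ ε₀ ε₂₉ B₃ B₃' a₀ a₁, ZrOfRecord₁₃ F N (theta13OfThm1CCMW F N j γ ε₀ ε₂₉ B₃ B₃' a₀ a₁)⟩).toStage13Params P k) * (Fintype.card (Site (F.P P.K) k) : ℝ)) ≤ densOfRecord₁₃ F N (Stage13HParams.ofHistoryBlind F N ⟨theta13OfThm1CCMW F N j γ ε₀ ε₂₉ B₃ B₃' a₀ a₁, ZrOfRecord₁₃ F N (theta13OfThm1CCMW F N j γ ε₀ ε₂₉ B₃ B₃' a₀ a₁)⟩).toStage13Params P k U ∧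
        densOfRecord₁₃ F N (Stage13HParams.ofHistoryBlind F N ⟨theta13OfThm1CCMW F N j γ ε₀ ε₂₉ B₃ B₃' a₀ a₁, ZrOfRecord₁₃ F N (theta13OfThm1CCMW F N j γ ε₀ ε₂₉ B₃ B₃' a₀ a₁)⟩).toStage13Params P k U ≤ Real.exp (w.ep (gOfRecord₁₃ F N (Stage13HParams.ofHistoryBlind F N ⟨theta13OfThm1CCMW F N j γ ε₀ ε₂₉ B₃ B₃' a₀ a₁, ZrOfRecord₁₃ F N (theta13OfThm1CCMW F N j γ ε₀ ε₂₉ B₃ B₃' a₀ a₁)⟩).toStage13Params P k) * (Fintype.card (Site (F.P P.K) k) : ℝ)) :=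
    fun P hI k hk hS U => hUV P (B14Cor3.inInterval_of_le hI hγw13) k hk hS U
  have hR := N24_recordS₁₃SepCoPH_of_upS_rebindX_view (Stage13HParams.ofHistoryBlind F N ⟨theta13OfThm1CCMW F N j γ ε₀ ε₂₉ B₃ B₃' a₀ a₁, ZrOfRecord₁₃ F N (theta13OfThm1CCMW F N j γ ε₀ ε₂₉ B₃ B₃' a₀ a₁)⟩) (N24_provisos₁₃SepCoPH_door_theta13OfThm1CCMW_of_gauge9TopStepR_of_betaBoxSignFree_allTorus hγ₀ hγh hε hε' hB hB' ha₀ ha₁ h15 hc h9 hbox hbox' hl hβ') hθ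
    (fun P : B12.RunParams => (((((theta13OfThm1CCMW F N j γ ε₀ ε₂₉ B₃ B₃' a₀ a₁).res.X P).withB8OfRecordSubBP (theta13OfThm1CCMW F N j γ ε₀ ε₂₉ B₃ B₃' a₀ a₁).toStage3Params lam8).withB12 (F12OfRecord₁₂ F N (theta13OfThm1CCMW F N j γ ε₀ ε₂₉ B₃ B₃' a₀ a₁).toStage12Params lam12 P) (lam12 P).consts).withB13OfRecord (theta13OfThm1CCMW F N j γ ε₀ ε₂₉ B₃ B₃' a₀ a₁).toStage3Params (lam13 P))) Mstar ops ζ lamW w hC ⟨hγw0, hγwγ⟩ rfl (fun P => rfl)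
  have hnodes := N24_nodes₁₃CoPH_rebindXS_fourPin_pointed (Stage13HParams.ofHistoryBlind F N ⟨theta13OfThm1CCMW F N j γ ε₀ ε₂₉ B₃ B₃' a₀ a₁, ZrOfRecord₁₃ F N (theta13OfThm1CCMW F N j γ ε₀ ε₂₉ B₃ B₃' a₀ a₁)⟩) (N24_provisos₁₃SepCoPH_door_theta13OfThm1CCMW_of_gauge9TopStepR_of_betaBoxSignFree_allTorus hγ₀ hγh hε hε' hB hB' ha₀ ha₁ h15 hc h9 hbox hbox' hl hβ').toCore hθ
    (fun P : B12.RunParams => (((((theta13OfThm1CCMW F N j γ ε₀ ε₂₉ B₃ B₃' a₀ a₁).res.X P).withB8OfRecordSubBP (theta13OfThm1CCMW F N j γ ε₀ ε₂₉ B₃ B₃' a₀ a₁).toStage3Params lam8).withB12 (F12OfRecord₁₂ F N (theta13OfThm1CCMW F N j γ ε₀ ε₂₉ B₃ B₃' a₀ a₁).toStage12Params lam12 P) (lam12 P).consts).withB13OfRecord (theta13OfThm1CCMW F N j γ ε₀ ε₂₉ B₃ B₃' a₀ a₁).toStage3Params (lam13 P))) Mstar ops ζ lamW w hC ⟨hγw0,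 hγwγ⟩ rfl (fun P => rfl)
    (fun P => h05) h06 h07 h08 (fun P => h09 P) (h09T w hC hγw9) (fun P _ _ _ _ => h10 P) (h11 w hC rfl rfl hγw11) h12 hlaws hUVw
  exact ⟨_, _, w, hU, hθ, hR, hnodes, b, r, γR, B, M, hγR, hrem, hbB, le_rfl, hps⟩

end generalN

/-! ## §3–§4. `N = 2`: K1⁷'s consequent and the v6 rung-2″ body at `F` from V19's three stub texts at `F`, the SPLIT children families (N05 on the P-slot) and NODE O's RUN-ROW family -/

/-- **★★★ K1⁷'s θ-KEYED CONSEQUENT AT THE FAMILY `F` FROM EXACTLY V19's THREE STUB TEXTS AT `F`, TEN WORLD-FREE CHILDREN FAMILIES (Part 23's types, N05 on the P-slot) AND NODE O's RUN-ROW FAMILY**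
— `h1F ∕ h2PF ∕ h3A'F` = the bodies of V19's registered stubs read at `F` (verbatim as in dag-n21-c PART 2); `h05F … hUVF` as in Part 23 §3; `hrowsF` = for every door member, the RUN ROWS
of the witness's β of record on SOME level (`∃ b r γR B M, 0 < γR ∧ RunConstRemainder … ∧ (∀ k, b k ≤ B) ∧ (partial-sum floor −M)`) — NODE O's K1-side obligation in v6's currency,
stated ONCE for all door letters.  PROOF: Part 19's stub-opening verbatim, then §1 at the families.
So «WHICH CHILD BLOCKS K1⁷» (closing form, V19∕v6): V19's three print stubs + `h05F h06F h07 h08 h09F h09TF h10F h11F h12F hUVF` + NODE O's `hrowsF`; the world, the ceiling match and the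
door plumbing are N24's and DONE here.  COMPOSITE and CONDITIONAL: every hypothesis displayed; nothing of Bałaban asserted; K0⁷ ∕ K1⁷ NOT closed; no stub closed; no count moved. [cite: Balaban1989LargeFieldII, Thm 1 p.355, (0.1) pp.355–356, p.391; Balaban1988Convergent, Thm 1 p.262, Cor. 3 (2.50) p.264, (2.6) p.255, (3.16)–(3.23) pp.268–270; Balaban1987RG1, Thm 1 p.255, Thm 2 p.259, Thm 3 p.264, Lemma 4 p.280, (0.17)–(0.20) pp.255–256, (1.20)–(1.22) p.264, (5.10) p.293; Balaban1988RG2Cluster, (2.41) p.21, Lemmas 1–3 pp.9–20; Balaban1985Variational, Thm 1 (8)–(9) p.279, Prop. 8 p.304; Balaban1985RegularSpaces, Lemma 1 p.79 – Thm 8 p.101, Prop. 6 p.99; Balaban1985UV3, Thm 1 p.257; Balaban1989LargeFieldI, Prop. 1 p.194 (bookkeeping)] -/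
theorem N24_stabilityBR13SepCoPH_consequent_of_stubs1_2P_3A'_of_childrenSplit_of_runRows
    (h1F : ∃ B₃ a₀ a₁ : ℝ, 2 * (F.L : ℝ) ^ 2 ≤ B₃ ∧ 0 < a₀ ∧ 0 < a₁ ∧
      Prop8RegSepTopStep F 2 (fun ν K Ω => suppDomOfRecord F ν K Ω) B₃ a₀ a₁)
    (h2PF : ∃ (ρ₀ : ℕ) (B₁ c₁ : ℝ), 1 ≤ ρ₀ ∧ 0 ≤ B₁ ∧ 0 < c₁ ∧
      (letI : CStarAlgebra (MatA 2) := {}; B8.Prop6Printed 4 (F.L : ℝ) B₁ c₁ (fun i : B8LeafModelZd.ZdIdx 4 F.L => zdCubP (MatA 2) F.L ρ₀ i)))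
    (h3A'F : ∀ (j c : ℕ) (B₃ B₃' a₀ a₁ : ℝ), c ≤ F.L ^ j → 2 * (F.L : ℝ) ^ 2 ≤ B₃ → 0 < B₃' → 0 < a₀ → 0 < a₁ →
      VariationalThm1RegSepCoP7M F 2 B₃ a₀ a₁ →
      Gauge9RegSepTopStepR F 2 (fun ν K Ω => suppDomOfRecord F ν K Ω) (F.L ^ j) c B₃ B₃' a₀ a₁ →
      ∃ γ₀ ε₀ ε₂₉ β' : ℝ, 0 < γ₀ ∧ 0 < ε₀ ∧ 0 < ε₂₉ ∧
        BetaLowerH (-β') γ₀ (betaOfRecord₁₃ F 2 (theta13OfThm1CCM F 2 j ε₀ ε₂₉ B₃ B₃' a₀ a₁)) ∧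
        BetaUpperH β' γ₀ (betaOfRecord₁₃ F 2 (theta13OfThm1CCM F 2 j ε₀ ε₂₉ B₃ B₃' a₀ a₁)))
    (h05F : ∀ {j c : ℕ} {γ ε₀ ε₂₉ B₃ B₃' a₀ a₁ : ℝ} (hγ₀ : 0 < γ) (hγh : γ ≤ 1 / 2) (hε : 0 < ε₀) (hε' : 0 < ε₂₉) (hB : 0 ≤ B₃) (hB' : 0 ≤ B₃') (ha₀ : 0 < a₀) (ha₁ : 0 < a₁) (h15 : VariationalThm1RegSepCoP7M F 2 B₃ a₀ a₁) (hc : c ≤ F.L ^ j) (h9 : Gauge9RegSepTopStepR F 2 (fun ν K Ω => suppDomOfRecord F ν K Ω) (F.L ^ j) c B₃ B₃' a₀ a₁) {bl β' : ℝ} (hbox : BetaLowerH bl γ (betaOfRecord₁₃ F 2 (theta13OfThm1CCMW F 2 j γ ε₀ ε₂₉ B₃ B₃' a₀ a₁))) (hbox' : BetaUpperH β' γ (betaOfRecord₁₃ F 2 (theta13OfThm1CCMW F 2 j γ ε₀ ε₂₉ B₃ B₃' a₀ a₁))) (hl : -bl * γ ^ 2 ≤ 3) (hβ' : β' * γ ^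 2 ≤ 3 / 4),
      ∃ lam8 : ResidB8 (theta13OfThm1CCMW F 2 j γ ε₀ ε₂₉ B₃ B₃' a₀ a₁).toStage3Params, B8LeafOfRecordSubBP (theta13OfThm1CCMW F 2 j γ ε₀ ε₂₉ B₃ B₃' a₀ a₁).toStage3Params lam8)
    (h06F : ∀ {j c : ℕ} {γ ε₀ ε₂₉ B₃ B₃' a₀ a₁ : ℝ} (hγ₀ : 0 < γ) (hγh : γ ≤ 1 / 2) (hε : 0 < ε₀) (hε' : 0 < ε₂₉) (hB : 0 ≤ B₃) (hB' : 0 ≤ B₃') (ha₀ : 0 < a₀) (ha₁ : 0 < a₁) (h15 : VariationalThm1RegSepCoP7M F 2 B₃ a₀ a₁) (hc : c ≤ F.L ^ j) (h9 : Gauge9RegSepTopStepR F 2 (fun ν K Ω => suppDomOfRecord F ν K Ω) (F.L ^ j) c B₃ B₃' a₀ a₁) {bl β' : ℝ} (hbox : BetaLowerH bl γ (betaOfRecord₁₃ F 2 (theta13OfThm1CCMW F 2 j γ ε₀ ε₂₉ B₃ B₃' a₀ a₁))) (hbox' : BetaUpperH β' γ (betaOfRecord₁₃ F 2 (theta13OfThm1CCMW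 F 2 j γ ε₀ ε₂₉ B₃ B₃' a₀ a₁))) (hl : -bl * γ ^ 2 ≤ 3) (hβ' : β' * γ ^ 2 ≤ 3 / 4),
      ∃ (Mstar : ℕ) (ops : OpsY 2 (theta13OfThm1CCMW F 2 j γ ε₀ ε₂₉ B₃ B₃' a₀ a₁).toStage3Params Mstar), B9LeafX (Y9OfRecord 2 (theta13OfThm1CCMW F 2 j γ ε₀ ε₂₉ B₃ B₃' a₀ a₁).toStage3Params Mstar ops))
    (h07 : ∃ ζ : ResidZ F 2, B11Leaf (Z11OfRecord F 2 ζ))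
    (h08 : PrintedUV3V 2 F.L)
    (h09F : ∀ {j c : ℕ} {γ ε₀ ε₂₉ B₃ B₃' a₀ a₁ : ℝ} (hγ₀ : 0 < γ) (hγh : γ ≤ 1 / 2) (hε : 0 < ε₀) (hε' : 0 < ε₂₉) (hB : 0 ≤ B₃) (hB' : 0 ≤ B₃') (ha₀ : 0 < a₀) (ha₁ : 0 < a₁) (h15 : VariationalThm1RegSepCoP7M F 2 B₃ a₀ a₁) (hc : c ≤ F.L ^ j) (h9 : Gauge9RegSepTopStepR F 2 (fun ν K Ω => suppDomOfRecord F ν K Ω) (F.L ^ j) c B₃ B₃' a₀ a₁) {bl β' : ℝ} (hbox : BetaLowerH bl γ (betaOfRecord₁₃ F 2 (theta13OfThm1CCMW F 2 j γ ε₀ ε₂₉ B₃ B₃' a₀ a₁))) (hbox' : BetaUpperH β' γ (betaOfRecord₁₃ F 2 (theta13OfThm1CCMW F 2 j γ ε₀ ε₂₉ B₃ B₃' a₀ a₁))) (hl : -bl * γ ^ 2 ≤ 3) (hβ' : β' * γ ^ 2 ≤ 3 / 4),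
      ∃ lam12 : ResidB12 F 2 (theta13OfThm1CCMW F 2 j γ ε₀ ε₂₉ B₃ B₃' a₀ a₁).τ9.M,
      ∀ P : B12.RunParams, B12Sec2to5.Lemma4Printed (F12OfRecord₁₂ F 2 (theta13OfThm1CCMW F 2 j γ ε₀ ε₂₉ B₃ B₃' a₀ a₁).toStage12Params lam12 P) (lam12 P).consts)
    (h09TF : ∀ {j c : ℕ} {γ ε₀ ε₂₉ B₃ B₃' a₀ a₁ : ℝ} (hγ₀ : 0 < γ) (hγh : γ ≤ 1 / 2) (hε : 0 < ε₀) (hε' : 0 < ε₂₉) (hB : 0 ≤ B₃) (hB' : 0 ≤ B₃') (ha₀ : 0 < a₀) (ha₁ : 0 < a₁) (h15 : VariationalThm1RegSepCoP7M F 2 B₃ a₀ a₁) (hc : c ≤ F.L ^ j) (h9 : Gauge9RegSepTopStepR F 2 (fun ν K Ω => suppDomOfRecord F ν K Ω) (F.L ^ j) c B₃ B₃' a₀ a₁) {bl β' : ℝ} (hbox : BetaLowerH bl γ (betaOfRecord₁₃ F 2 (theta13OfThm1CCMW F 2 j γ ε₀ ε₂₉ B₃ B₃' a₀ a₁))) (hbox'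 : BetaUpperH β' γ (betaOfRecord₁₃ F 2 (theta13OfThm1CCMW F 2 j γ ε₀ ε₂₉ B₃ B₃' a₀ a₁))) (hl : -bl * γ ^ 2 ≤ 3) (hβ' : β' * γ ^ 2 ≤ 3 / 4),
      ∃ γ₉ : ℝ, 0 < γ₉ ∧ ∀ w : WorldP, w.C = (datumOfRecord₁₃SepCoPH F 2 (Stage13HParams.ofHistoryBlind F 2 ⟨theta13OfThm1CCMW F 2 j γ ε₀ ε₂₉ B₃ B₃' a₀ a₁, ZrOfRecord₁₃ F 2 (theta13OfThm1CCMW F 2 j γ ε₀ ε₂₉ B₃ B₃' a₀ a₁)⟩) (N24_provisos₁₃SepCoPH_door_theta13OfThm1CCMW_of_gauge9TopStepR_of_betaBoxSignFree_allTorus hγ₀ hγh hε hε' hB hB' ha₀ ha₁ h15 hc h9 hbox hbox' hl hβ')).C →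
      w.γ ≤ γ₉ → ∀ P : B12.RunParams, (leavesP w P).smallCouplings → (leavesP w P).smallFieldInductive)
    (h10F : ∀ {j c : ℕ} {γ ε₀ ε₂₉ B₃ B₃' a₀ a₁ : ℝ} (hγ₀ : 0 < γ) (hγh : γ ≤ 1 / 2) (hε : 0 < ε₀) (hε' : 0 < ε₂₉) (hB : 0 ≤ B₃) (hB' : 0 ≤ B₃') (ha₀ : 0 < a₀) (ha₁ : 0 < a₁) (h15 : VariationalThm1RegSepCoP7M F 2 B₃ a₀ a₁) (hc : c ≤ F.L ^ j) (h9 : Gauge9RegSepTopStepR F 2 (fun ν K Ω => suppDomOfRecord F ν K Ω) (F.L ^ j) c B₃ B₃' a₀ a₁) {bl β' : ℝ} (hbox : BetaLowerH bl γ (betaOfRecord₁₃ F 2 (theta13OfThm1CCMW F 2 j γ ε₀ ε₂₉ B₃ B₃' a₀ a₁))) (hbox' : BetaUpperH β' γ (betaOfRecord₁₃ F 2 (theta13OfThm1CCMW F 2 j γ ε₀ ε₂₉ B₃ B₃' a₀ a₁))) (hl : -bl * γ ^ 2 ≤ 3) (hβ' : β' * γ ^ 2 ≤ 3 / 4),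
      ∃ lam13 : B12.RunParams → ResidB13 (theta13OfThm1CCMW F 2 j γ ε₀ ε₂₉ B₃ B₃' a₀ a₁).toStage3Params,
      ∀ P : B12.RunParams, B13LeafOfRecord (theta13OfThm1CCMW F 2 j γ ε₀ ε₂₉ B₃ B₃' a₀ a₁).toStage3Params (lam13 P))
    (h11F : ∀ {j c : ℕ} {γ ε₀ ε₂₉ B₃ B₃' a₀ a₁ : ℝ} (hγ₀ : 0 < γ) (hγh : γ ≤ 1 / 2) (hε : 0 < ε₀) (hε' : 0 < ε₂₉) (hB : 0 ≤ B₃) (hB' : 0 ≤ B₃') (ha₀ : 0 < a₀) (ha₁ : 0 < a₁) (h15 : VariationalThm1RegSepCoP7M F 2 B₃ a₀ a₁) (hc : c ≤ F.L ^ j) (h9 : Gauge9RegSepTopStepR F 2 (fun ν K Ω => suppDomOfRecord F ν K Ω) (F.L ^ j) c B₃ B₃' a₀ a₁) {bl β' : ℝ} (hbox : BetaLowerH bl γ (betaOfRecord₁₃ F 2 (theta13OfThm1CCMW F 2 j γ ε₀ ε₂₉ B₃ B₃' a₀ a₁))) (hbox' : BetaUpperH β' γ (betaOfRecord₁₃ F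 2 (theta13OfThm1CCMW F 2 j γ ε₀ ε₂₉ B₃ B₃' a₀ a₁))) (hl : -bl * γ ^ 2 ≤ 3) (hβ' : β' * γ ^ 2 ≤ 3 / 4),
      ∀ βup β₀ : ℝ, ∃ γ₁₁ : ℝ, 0 < γ₁₁ ∧ ∀ w : WorldP, w.C = (datumOfRecord₁₃SepCoPH F 2 (Stage13HParams.ofHistoryBlind F 2 ⟨theta13OfThm1CCMW F 2 j γ ε₀ ε₂₉ B₃ B₃' a₀ a₁, ZrOfRecord₁₃ F 2 (theta13OfThm1CCMW F 2 j γ ε₀ ε₂₉ B₃ B₃' a₀ a₁)⟩) (N24_provisos₁₃SepCoPH_door_theta13OfThm1CCMW_of_gauge9TopStepR_of_betaBoxSignFree_allTorus hγ₀ hγh hε hε' hB hB' ha₀ ha₁ h15 hc h9 hbox hbox' hl hβ')).C →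
      w.βup = βup → w.β₀ = β₀ → w.γ ≤ γ₁₁ → ∀ P : B12.RunParams, (leavesP w P).b7 → (leavesP w P).b8 → (leavesP w P).b9 → (leavesP w P).b10 → (leavesP w P).b11 →
      (leavesP w P).smallCouplings → (leavesP w P).smallFieldInductive → (leavesP w P).flowControl →
        ∀ k, k < P.K → SLaw₁₃CoPH F 2 (Stage13HParams.ofHistoryBlind F 2 ⟨theta13OfThm1CCMW F 2 j γ ε₀ ε₂₉ B₃ B₃' a₀ a₁, ZrOfRecord₁₃ F 2 (theta13OfThm1CCMW F 2 j γ ε₀ ε₂₉ B₃ B₃' a₀ a₁)⟩) P k → TLaw₁₃CoPH F 2 (Stage13HParams.ofHistoryBlind F 2 ⟨theta13OfThm1CCMW F 2 j γ ε₀ ε₂₉ B₃ B₃' a₀ a₁, ZrOfRecord₁₃ F 2 (theta13OfThm1CCMW F 2 j γ ε₀ ε₂₉ B₃ B₃' a₀ a₁)⟩) P k)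
    (h12F : ∀ {j c : ℕ} {γ ε₀ ε₂₉ B₃ B₃' a₀ a₁ : ℝ} (hγ₀ : 0 < γ) (hγh : γ ≤ 1 / 2) (hε : 0 < ε₀) (hε' : 0 < ε₂₉) (hB : 0 ≤ B₃) (hB' : 0 ≤ B₃') (ha₀ : 0 < a₀) (ha₁ : 0 < a₁) (h15 : VariationalThm1RegSepCoP7M F 2 B₃ a₀ a₁) (hc : c ≤ F.L ^ j) (h9 : Gauge9RegSepTopStepR F 2 (fun ν K Ω => suppDomOfRecord F ν K Ω) (F.L ^ j) c B₃ B₃' a₀ a₁) {bl β' : ℝ} (hbox : BetaLowerH bl γ (betaOfRecord₁₃ F 2 (theta13OfThm1CCMW F 2 j γ ε₀ ε₂₉ B₃ B₃' a₀ a₁))) (hbox' : BetaUpperH β' γ (betaOfRecord₁₃ F 2 (theta13OfThm1CCMW F 2 j γ ε₀ ε₂₉ B₃ B₃' a₀ a₁))) (hl : -bl * γ ^ 2 ≤ 3) (hβ' : β' * γ ^ 2 ≤ 3 / 4),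
      ∃ lamW : ResidW F 2, (∀ P : B12.RunParams, B15Leaf (WOfRecord₁₃ F 2 (theta13OfThm1CCMW F 2 j γ ε₀ ε₂₉ B₃ B₃' a₀ a₁) lamW P)) ∧
      ∀ P : B12.RunParams, 1 ≤ P.K → lamW.kSel P < P.K)
    (hUVF : ∀ {j c : ℕ} {γ ε₀ ε₂₉ B₃ B₃' a₀ a₁ : ℝ} (hγ₀ : 0 < γ) (hγh : γ ≤ 1 / 2) (hε : 0 < ε₀) (hε' : 0 < ε₂₉) (hB : 0 ≤ B₃) (hB' : 0 ≤ B₃') (ha₀ : 0 < a₀) (ha₁ : 0 < a₁) (h15 : VariationalThm1RegSepCoP7M F 2 B₃ a₀ a₁) (hc : c ≤ F.L ^ j) (h9 : Gauge9RegSepTopStepR F 2 (fun ν K Ω => suppDomOfRecord F ν K Ω) (F.L ^ j) c B₃ B₃' a₀ a₁) {bl β' : ℝ} (hbox : BetaLowerH bl γ (betaOfRecord₁₃ F 2 (theta13OfThm1CCMW F 2 j γ ε₀ ε₂₉ B₃ B₃' a₀ a₁))) (hbox' : BetaUpperH β' γ (betaOfRecord₁₃ F 2 (theta13OfThm1CCMW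 F 2 j γ ε₀ ε₂₉ B₃ B₃' a₀ a₁))) (hl : -bl * γ ^ 2 ≤ 3) (hβ' : β' * γ ^ 2 ≤ 3 / 4),
      ∃ γ₁₃ : ℝ, 0 < γ₁₃ ∧ ∃ em ep : ℝ → ℝ, ∀ P : B12.RunParams, (genFlow (betaOfRecord₁₃ F 2 (theta13OfThm1CCMW F 2 j γ ε₀ ε₂₉ B₃ B₃' a₀ a₁)) P.g0).InInterval γ₁₃ P.K → ∀ k, k ≤ P.K → SLaw₁₃CoPH F 2 (Stage13HParams.ofHistoryBlind F 2 ⟨theta13OfThm1CCMW F 2 j γ ε₀ ε₂₉ B₃ B₃' a₀ a₁, ZrOfRecord₁₃ F 2 (theta13OfThm1CCMW F 2 j γ ε₀ ε₂₉ B₃ B₃' a₀ a₁)⟩) P k →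
      ∀ U : GaugeField (F.P P.K) k (SU 2),
        chiβOfRecord₁₃ F 2 (theta13OfThm1CCMW F 2 j γ ε₀ ε₂₉ B₃ B₃' a₀ a₁) P.K (gOfRecord₁₃ F 2 (theta13OfThm1CCMW F 2 j γ ε₀ ε₂₉ B₃ B₃' a₀ a₁) P) k U *
              Real.exp (-(1 / (gOfRecord₁₃ F 2 (theta13OfThm1CCMW F 2 j γ ε₀ ε₂₉ B₃ B₃' a₀ a₁) P k) ^ 2 * wilsonBGOfRecord F 2 (theta13OfThm1CCMW F 2 j γ ε₀ ε₂₉ B₃ B₃' a₀ a₁).εbg P k U)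
                - em (gOfRecord₁₃ F 2 (theta13OfThm1CCMW F 2 j γ ε₀ ε₂₉ B₃ B₃' a₀ a₁) P k) * (Fintype.card (Site (F.P P.K) k) : ℝ)) ≤ densOfRecord₁₃ F 2 (theta13OfThm1CCMW F 2 j γ ε₀ ε₂₉ B₃ B₃' a₀ a₁) P k U ∧
        densOfRecord₁₃ F 2 (theta13OfThm1CCMW F 2 j γ ε₀ ε₂₉ B₃ B₃' a₀ a₁) P k U ≤ Real.exp (ep (gOfRecord₁₃ F 2 (theta13OfThm1CCMW F 2 j γ ε₀ ε₂₉ B₃ B₃' a₀ a₁) P k) * (Fintype.card (Site (F.P P.K) k) : ℝ)))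
    (hrowsF : ∀ {j c : ℕ} {γ ε₀ ε₂₉ B₃ B₃' a₀ a₁ : ℝ} (hγ₀ : 0 < γ) (hγh : γ ≤ 1 / 2) (hε : 0 < ε₀) (hε' : 0 < ε₂₉) (hB : 0 ≤ B₃) (hB' : 0 ≤ B₃') (ha₀ : 0 < a₀) (ha₁ : 0 < a₁) (h15 : VariationalThm1RegSepCoP7M F 2 B₃ a₀ a₁) (hc : c ≤ F.L ^ j) (h9 : Gauge9RegSepTopStepR F 2 (fun ν K Ω => suppDomOfRecord F ν K Ω) (F.L ^ j) c B₃ B₃' a₀ a₁) {bl β' : ℝ} (hbox : BetaLowerH bl γ (betaOfRecord₁₃ F 2 (theta13OfThm1CCMW F 2 j γ ε₀ ε₂₉ B₃ B₃' a₀ a₁))) (hbox' : BetaUpperH β' γ (betaOfRecord₁₃ F 2 (theta13OfThm1CCMW F 2 j γ ε₀ ε₂₉ B₃ B₃' a₀ a₁))) (hl : -bl * γ ^ 2 ≤ 3) (hβ' : β' * γ ^ 2 ≤ 3 / 4),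
      ∃ (b : ℕ → ℝ) (r γR B M : ℝ), 0 < γR ∧ RunConstRemainder (betaOfRecord₁₃ F 2 (theta13OfThm1CCMW F 2 j γ ε₀ ε₂₉ B₃ B₃' a₀ a₁)) b r γR ∧ (∀ k, b k ≤ B) ∧
      ∀ (n : ℕ) (gs : ℕ → ℝ), RGEqH n (betaOfRecord₁₃ F 2 (theta13OfThm1CCMW F 2 j γ ε₀ ε₂₉ B₃ B₃' a₀ a₁)) gs → Step.InInterval γR n gs →
        ∀ k, k ≤ n → -M ≤ ∑ i ∈ Finset.Ico k n, betaOfRecord₁₃ F 2 (theta13OfThm1CCMW F 2 j γ ε₀ ε₂₉ B₃ B₃' a₀ a₁) i (prefixOf gs i)) :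
    ∃ (θ' : Stage13HParams F 2) (h' : θ'.Provisos₁₃SepCoPH F 2), (θ'.ZhUnity F 2 ∧ θ'.SlotsNondegenerate₁₃ F 2) ∧ θ'.Admissible F 2 ∧
      B16.EndStatementBPrinted (datumOfRecord₁₃SepCoPH F 2 θ' h').C ∧
      ∃ γ₁ : ℝ, 0 < γ₁ ∧ ∀ γ : ℝ, 0 < γ → γ ≤ γ₁ → ∃ P : B12.RunParams, 1 ≤ P.K ∧ ((datumOfRecord₁₃SepCoPH F 2 θ' h').C P).flow.InInterval γ P.K := by
  obtain ⟨B₃, a₀, a₁, hB₃, ha₀, ha₁, h8⟩ := h1F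
  have hL0 : (0 : ℝ) < (F.L : ℝ) := by exact_mod_cast lt_trans Nat.zero_lt_one F.hL.2
  have hBpos : (0 : ℝ) < B₃ := lt_of_lt_of_le (mul_pos two_pos (pow_pos hL0 2)) hB₃
  obtain ⟨j, c, B₉, a₁', hc, hB9, ha₁', ha₁'le, h9⟩ := gauge9Supplier_of_prop6MemberP F h2PF B₃ a₀ a₁ hB₃ ha₀ ha₁ h8
  have h15 : VariationalThm1RegSepCoP7M F 2 B₃ a₀ a₁' := variationalThm1RegSepCoP7M_of_prop8TopStep hBpos (h8.of_le le_rfl ha₁'le)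
  obtain ⟨γ₀, ε₀, ε₂₉, β', hγ0, hε, hε', hlow, hup⟩ := h3A'F j c B₃ B₉ a₀ a₁' hc hB₃ hB9 ha₀ ha₁' h15 h9
  obtain ⟨γ, hγpos, hγh, hl, hu, hlow', hup'⟩ := windowLetters_of_absBetaBoxH hγ0 hlow hup
  have hloW := betaLowerH_theta13OfThm1CCMW_of_half (F := F) (N := 2) (j := j) (ε₀ := ε₀) (ε₂₉ := ε₂₉) (B₃ := B₃) (B₃' := B₉) (a₀ := a₀) (a₁ := a₁') hγh hlow'
  have hupW := betaUpperH_theta13OfThm1CCMW_of_half (F := F) (N := 2) (j := j) (ε₀ := ε₀) (ε₂₉ := ε₂₉) (B₃ := B₃) (B₃' := B₉) (a₀ := a₀) (a₁ := a₁') hγh hup'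
  obtain ⟨b, r, γR, B, M, hγR, hrem, hbB, hps⟩ := hrowsF hγpos hγh hε hε' hBpos.le hB9.le ha₀ ha₁' h15 hc h9 hloW hupW hl hu
  exact N24_stabilityBR13SepCoPH_worldBuilt_childrenSplit_runRows_theta13OfThm1CCMW_of_gauge9TopStepR_of_betaBoxSignFree_allTorus_door hγpos hγh hε hε' hBpos.le hB9.le ha₀ ha₁' h15 hc h9 hloW hupW hl hu
    (h05F hγpos hγh hε hε' hBpos.le hB9.le ha₀ ha₁' h15 hc h9 hloW hupW hl hu) (h06F hγpos hγh hε hε' hBpos.le hB9.le ha₀ ha₁' h15 hc h9 hloW hupW hl hu) h07 h08 (h09F hγpos hγh hε hε' hBpos.le hB9.le ha₀ ha₁' h15 hc h9 hloW hupW hl hu) (h09TF hγpos hγh hε hε' hBpos.le hB9.le ha₀ ha₁' h15 hc h9 hloW hupW hl hu) (h10F hγpos hγh hε hε' hBpos.le hB9.le ha₀ ha₁' h15 hc h9 hloW hupW hl hu) (h11F hγpos hγh hε hε' hBpos.le hB9.le ha₀ ha₁' h15 hc h9 hloW hupW hl hu) (h12F hγpos hγh hε hε' hBpos.le hB9.le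 ha₀ ha₁' h15 hc h9 hloW hupW hl hu) (hUVF hγpos hγh hε hε' hBpos.le hB9.le ha₀ ha₁' h15 hc h9 hloW hupW hl hu) hγR hrem hbB hps

/-- **★★ K1⁷ v6's RUNG-2″ BODY (`RunRowsAtSomeRecord13PWS F`'s text at `N = 2`, `RecordS` unfolded) AT THE FAMILY `F` FROM EXACTLY V19's THREE STUB TEXTS AT `F`, TEN WORLD-FREE CHILDREN FAMILIES
(N05 on the P-slot) AND NODE O's RUN-ROW FAMILY** — PROOF: Part 19's stub-opening, then §2.  So v6's registered stub 2″ `stub_runRows13PWS F _ :=` THIS THEOREM ∘ (V19's stubs as theorems) ∘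
(one world-free theorem per lane) ∘ (NODE O's run rows at the witness), re-choosing the rung-1 witness as the K0 door with N24's world; with Part 23 §4 (stub 1) v6's composition
`StabilityBAtRecordR13SepCoPH_ofRunRows` is then fed by name.  COMPOSITE and CONDITIONAL: every hypothesis displayed; nothing of Bałaban asserted; K0⁷ ∕ K1⁷ NOT closed; no stub closed; no count moved. [cite: Balaban1989LargeFieldII, Thm 1 p.355, (0.1) pp.355–356, p.391; Balaban1988Convergent, Thm 1 p.262, Cor. 3 (2.50) p.264, (2.6) p.255, (3.16)–(3.23) pp.268–270; Balaban1987RG1, Thm 1 p.255, Thm 2 p.259, Thm 3 p.264, Lemma 4 p.280, (0.17)–(0.20) pp.255–256, (1.20)–(1.22) p.264, (5.10) p.293; Balaban1988RG2Cluster, (2.41) p.21, Lemmas 1–3 pp.9–20; Balaban1985Variational, Thm 1 (8)–(9) p.279, Prop. 8 p.304; Balaban1985RegularSpaces, Lemma 1 p.79 – Thm 8 p.101, Prop. 6 p.99; Balaban1985UV3, Thm 1 p.257; Balaban1989LargeFieldI, Prop. 1 p.194 (bookkeeping)] -/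
theorem N24_runRowsAtSomeRecordS13PWS_of_stubs1_2P_3A'_of_childrenSplit_of_runRows
    (h1F : ∃ B₃ a₀ a₁ : ℝ, 2 * (F.L : ℝ) ^ 2 ≤ B₃ ∧ 0 < a₀ ∧ 0 < a₁ ∧
      Prop8RegSepTopStep F 2 (fun ν K Ω => suppDomOfRecord F ν K Ω) B₃ a₀ a₁)
    (h2PF : ∃ (ρ₀ : ℕ) (B₁ c₁ : ℝ), 1 ≤ ρ₀ ∧ 0 ≤ B₁ ∧ 0 < c₁ ∧
      (letI : CStarAlgebra (MatA 2) := {}; B8.Prop6Printed 4 (F.L : ℝ) B₁ c₁ (fun i : B8LeafModelZd.ZdIdx 4 F.L => zdCubP (MatA 2) F.L ρ₀ i)))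
    (h3A'F : ∀ (j c : ℕ) (B₃ B₃' a₀ a₁ : ℝ), c ≤ F.L ^ j → 2 * (F.L : ℝ) ^ 2 ≤ B₃ → 0 < B₃' → 0 < a₀ → 0 < a₁ →
      VariationalThm1RegSepCoP7M F 2 B₃ a₀ a₁ →
      Gauge9RegSepTopStepR F 2 (fun ν K Ω => suppDomOfRecord F ν K Ω) (F.L ^ j) c B₃ B₃' a₀ a₁ →
      ∃ γ₀ ε₀ ε₂₉ β' : ℝ, 0 < γ₀ ∧ 0 < ε₀ ∧ 0 < ε₂₉ ∧
        BetaLowerH (-β') γ₀ (betaOfRecord₁₃ F 2 (theta13OfThm1CCM F 2 j ε₀ ε₂₉ B₃ B₃' a₀ a₁)) ∧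
        BetaUpperH β' γ₀ (betaOfRecord₁₃ F 2 (theta13OfThm1CCM F 2 j ε₀ ε₂₉ B₃ B₃' a₀ a₁)))
    (h05F : ∀ {j c : ℕ} {γ ε₀ ε₂₉ B₃ B₃' a₀ a₁ : ℝ} (hγ₀ : 0 < γ) (hγh : γ ≤ 1 / 2) (hε : 0 < ε₀) (hε' : 0 < ε₂₉) (hB : 0 ≤ B₃) (hB' : 0 ≤ B₃') (ha₀ : 0 < a₀) (ha₁ : 0 < a₁) (h15 : VariationalThm1RegSepCoP7M F 2 B₃ a₀ a₁) (hc : c ≤ F.L ^ j) (h9 : Gauge9RegSepTopStepR F 2 (fun ν K Ω => suppDomOfRecord F ν K Ω) (F.L ^ j) c B₃ B₃' a₀ a₁) {bl β' : ℝ} (hbox : BetaLowerH bl γ (betaOfRecord₁₃ F 2 (theta13OfThm1CCMW F 2 j γ ε₀ ε₂₉ B₃ B₃' a₀ a₁))) (hbox' : BetaUpperH β' γ (betaOfRecord₁₃ F 2 (theta13OfThm1CCMW F 2 j γ ε₀ ε₂₉ B₃ B₃' a₀ a₁))) (hl : -bl * γ ^ 2 ≤ 3) (hβ' : β' * γ ^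 2 ≤ 3 / 4),
      ∃ lam8 : ResidB8 (theta13OfThm1CCMW F 2 j γ ε₀ ε₂₉ B₃ B₃' a₀ a₁).toStage3Params, B8LeafOfRecordSubBP (theta13OfThm1CCMW F 2 j γ ε₀ ε₂₉ B₃ B₃' a₀ a₁).toStage3Params lam8)
    (h06F : ∀ {j c : ℕ} {γ ε₀ ε₂₉ B₃ B₃' a₀ a₁ : ℝ} (hγ₀ : 0 < γ) (hγh : γ ≤ 1 / 2) (hε : 0 < ε₀) (hε' : 0 < ε₂₉) (hB : 0 ≤ B₃) (hB' : 0 ≤ B₃') (ha₀ : 0 < a₀) (ha₁ : 0 < a₁) (h15 : VariationalThm1RegSepCoP7M F 2 B₃ a₀ a₁) (hc : c ≤ F.L ^ j) (h9 : Gauge9RegSepTopStepR F 2 (fun ν K Ω => suppDomOfRecord F ν K Ω) (F.L ^ j) c B₃ B₃' a₀ a₁) {bl β' : ℝ} (hbox : BetaLowerH bl γ (betaOfRecord₁₃ F 2 (theta13OfThm1CCMW F 2 j γ ε₀ ε₂₉ B₃ B₃' a₀ a₁))) (hbox' : BetaUpperH β' γ (betaOfRecord₁₃ F 2 (theta13OfThm1CCMW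 F 2 j γ ε₀ ε₂₉ B₃ B₃' a₀ a₁))) (hl : -bl * γ ^ 2 ≤ 3) (hβ' : β' * γ ^ 2 ≤ 3 / 4),
      ∃ (Mstar : ℕ) (ops : OpsY 2 (theta13OfThm1CCMW F 2 j γ ε₀ ε₂₉ B₃ B₃' a₀ a₁).toStage3Params Mstar), B9LeafX (Y9OfRecord 2 (theta13OfThm1CCMW F 2 j γ ε₀ ε₂₉ B₃ B₃' a₀ a₁).toStage3Params Mstar ops))
    (h07 : ∃ ζ : ResidZ F 2, B11Leaf (Z11OfRecord F 2 ζ))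
    (h08 : PrintedUV3V 2 F.L)
    (h09F : ∀ {j c : ℕ} {γ ε₀ ε₂₉ B₃ B₃' a₀ a₁ : ℝ} (hγ₀ : 0 < γ) (hγh : γ ≤ 1 / 2) (hε : 0 < ε₀) (hε' : 0 < ε₂₉) (hB : 0 ≤ B₃) (hB' : 0 ≤ B₃') (ha₀ : 0 < a₀) (ha₁ : 0 < a₁) (h15 : VariationalThm1RegSepCoP7M F 2 B₃ a₀ a₁) (hc : c ≤ F.L ^ j) (h9 : Gauge9RegSepTopStepR F 2 (fun ν K Ω => suppDomOfRecord F ν K Ω) (F.L ^ j) c B₃ B₃' a₀ a₁) {bl β' : ℝ} (hbox : BetaLowerH bl γ (betaOfRecord₁₃ F 2 (theta13OfThm1CCMW F 2 j γ ε₀ ε₂₉ B₃ B₃' a₀ a₁))) (hbox' : BetaUpperH β' γ (betaOfRecord₁₃ F 2 (theta13OfThm1CCMW F 2 j γ ε₀ ε₂₉ B₃ B₃' a₀ a₁))) (hl : -bl * γ ^ 2 ≤ 3) (hβ' : β' * γ ^ 2 ≤ 3 / 4),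
      ∃ lam12 : ResidB12 F 2 (theta13OfThm1CCMW F 2 j γ ε₀ ε₂₉ B₃ B₃' a₀ a₁).τ9.M,
      ∀ P : B12.RunParams, B12Sec2to5.Lemma4Printed (F12OfRecord₁₂ F 2 (theta13OfThm1CCMW F 2 j γ ε₀ ε₂₉ B₃ B₃' a₀ a₁).toStage12Params lam12 P) (lam12 P).consts)
    (h09TF : ∀ {j c : ℕ} {γ ε₀ ε₂₉ B₃ B₃' a₀ a₁ : ℝ} (hγ₀ : 0 < γ) (hγh : γ ≤ 1 / 2) (hε : 0 < ε₀) (hε' : 0 < ε₂₉) (hB : 0 ≤ B₃) (hB' : 0 ≤ B₃') (ha₀ : 0 < a₀) (ha₁ : 0 < a₁) (h15 : VariationalThm1RegSepCoP7M F 2 B₃ a₀ a₁) (hc : c ≤ F.L ^ j) (h9 : Gauge9RegSepTopStepR F 2 (fun ν K Ω => suppDomOfRecord F ν K Ω) (F.L ^ j) c B₃ B₃' a₀ a₁) {bl β' : ℝ} (hbox : BetaLowerH bl γ (betaOfRecord₁₃ F 2 (theta13OfThm1CCMW F 2 j γ ε₀ ε₂₉ B₃ B₃' a₀ a₁))) (hbox'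 : BetaUpperH β' γ (betaOfRecord₁₃ F 2 (theta13OfThm1CCMW F 2 j γ ε₀ ε₂₉ B₃ B₃' a₀ a₁))) (hl : -bl * γ ^ 2 ≤ 3) (hβ' : β' * γ ^ 2 ≤ 3 / 4),
      ∃ γ₉ : ℝ, 0 < γ₉ ∧ ∀ w : WorldP, w.C = (datumOfRecord₁₃SepCoPH F 2 (Stage13HParams.ofHistoryBlind F 2 ⟨theta13OfThm1CCMW F 2 j γ ε₀ ε₂₉ B₃ B₃' a₀ a₁, ZrOfRecord₁₃ F 2 (theta13OfThm1CCMW F 2 j γ ε₀ ε₂₉ B₃ B₃' a₀ a₁)⟩) (N24_provisos₁₃SepCoPH_door_theta13OfThm1CCMW_of_gauge9TopStepR_of_betaBoxSignFree_allTorus hγ₀ hγh hε hε' hB hB' ha₀ ha₁ h15 hc h9 hbox hbox' hl hβ')).C →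
      w.γ ≤ γ₉ → ∀ P : B12.RunParams, (leavesP w P).smallCouplings → (leavesP w P).smallFieldInductive)
    (h10F : ∀ {j c : ℕ} {γ ε₀ ε₂₉ B₃ B₃' a₀ a₁ : ℝ} (hγ₀ : 0 < γ) (hγh : γ ≤ 1 / 2) (hε : 0 < ε₀) (hε' : 0 < ε₂₉) (hB : 0 ≤ B₃) (hB' : 0 ≤ B₃') (ha₀ : 0 < a₀) (ha₁ : 0 < a₁) (h15 : VariationalThm1RegSepCoP7M F 2 B₃ a₀ a₁) (hc : c ≤ F.L ^ j) (h9 : Gauge9RegSepTopStepR F 2 (fun ν K Ω => suppDomOfRecord F ν K Ω) (F.L ^ j) c B₃ B₃' a₀ a₁) {bl β' : ℝ} (hbox : BetaLowerH bl γ (betaOfRecord₁₃ F 2 (theta13OfThm1CCMW F 2 j γ ε₀ ε₂₉ B₃ B₃' a₀ a₁))) (hbox' : BetaUpperH β' γ (betaOfRecord₁₃ F 2 (theta13OfThm1CCMW F 2 j γ ε₀ ε₂₉ B₃ B₃' a₀ a₁))) (hl : -bl * γ ^ 2 ≤ 3) (hβ' : β' * γ ^ 2 ≤ 3 / 4),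
      ∃ lam13 : B12.RunParams → ResidB13 (theta13OfThm1CCMW F 2 j γ ε₀ ε₂₉ B₃ B₃' a₀ a₁).toStage3Params,
      ∀ P : B12.RunParams, B13LeafOfRecord (theta13OfThm1CCMW F 2 j γ ε₀ ε₂₉ B₃ B₃' a₀ a₁).toStage3Params (lam13 P))
    (h11F : ∀ {j c : ℕ} {γ ε₀ ε₂₉ B₃ B₃' a₀ a₁ : ℝ} (hγ₀ : 0 < γ) (hγh : γ ≤ 1 / 2) (hε : 0 < ε₀) (hε' : 0 < ε₂₉) (hB : 0 ≤ B₃) (hB' : 0 ≤ B₃') (ha₀ : 0 < a₀) (ha₁ : 0 < a₁) (h15 : VariationalThm1RegSepCoP7M F 2 B₃ a₀ a₁) (hc : c ≤ F.L ^ j) (h9 : Gauge9RegSepTopStepR F 2 (fun ν K Ω => suppDomOfRecord F ν K Ω) (F.L ^ j) c B₃ B₃' a₀ a₁) {bl β' : ℝ} (hbox : BetaLowerH bl γ (betaOfRecord₁₃ F 2 (theta13OfThm1CCMW F 2 j γ ε₀ ε₂₉ B₃ B₃' a₀ a₁))) (hbox' : BetaUpperH β' γ (betaOfRecord₁₃ F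 2 (theta13OfThm1CCMW F 2 j γ ε₀ ε₂₉ B₃ B₃' a₀ a₁))) (hl : -bl * γ ^ 2 ≤ 3) (hβ' : β' * γ ^ 2 ≤ 3 / 4),
      ∀ βup β₀ : ℝ, ∃ γ₁₁ : ℝ, 0 < γ₁₁ ∧ ∀ w : WorldP, w.C = (datumOfRecord₁₃SepCoPH F 2 (Stage13HParams.ofHistoryBlind F 2 ⟨theta13OfThm1CCMW F 2 j γ ε₀ ε₂₉ B₃ B₃' a₀ a₁, ZrOfRecord₁₃ F 2 (theta13OfThm1CCMW F 2 j γ ε₀ ε₂₉ B₃ B₃' a₀ a₁)⟩) (N24_provisos₁₃SepCoPH_door_theta13OfThm1CCMW_of_gauge9TopStepR_of_betaBoxSignFree_allTorus hγ₀ hγh hε hε' hB hB' ha₀ ha₁ h15 hc h9 hbox hbox' hl hβ')).C →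
      w.βup = βup → w.β₀ = β₀ → w.γ ≤ γ₁₁ → ∀ P : B12.RunParams, (leavesP w P).b7 → (leavesP w P).b8 → (leavesP w P).b9 → (leavesP w P).b10 → (leavesP w P).b11 →
      (leavesP w P).smallCouplings → (leavesP w P).smallFieldInductive → (leavesP w P).flowControl →
        ∀ k, k < P.K → SLaw₁₃CoPH F 2 (Stage13HParams.ofHistoryBlind F 2 ⟨theta13OfThm1CCMW F 2 j γ ε₀ ε₂₉ B₃ B₃' a₀ a₁, ZrOfRecord₁₃ F 2 (theta13OfThm1CCMW F 2 j γ ε₀ ε₂₉ B₃ B₃' a₀ a₁)⟩) P k → TLaw₁₃CoPH F 2 (Stage13HParams.ofHistoryBlind F 2 ⟨theta13OfThm1CCMW F 2 j γ ε₀ ε₂₉ B₃ B₃' a₀ a₁, ZrOfRecord₁₃ F 2 (theta13OfThm1CCMW F 2 j γ ε₀ ε₂₉ B₃ B₃' a₀ a₁)⟩) P k)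
    (h12F : ∀ {j c : ℕ} {γ ε₀ ε₂₉ B₃ B₃' a₀ a₁ : ℝ} (hγ₀ : 0 < γ) (hγh : γ ≤ 1 / 2) (hε : 0 < ε₀) (hε' : 0 < ε₂₉) (hB : 0 ≤ B₃) (hB' : 0 ≤ B₃') (ha₀ : 0 < a₀) (ha₁ : 0 < a₁) (h15 : VariationalThm1RegSepCoP7M F 2 B₃ a₀ a₁) (hc : c ≤ F.L ^ j) (h9 : Gauge9RegSepTopStepR F 2 (fun ν K Ω => suppDomOfRecord F ν K Ω) (F.L ^ j) c B₃ B₃' a₀ a₁) {bl β' : ℝ} (hbox : BetaLowerH bl γ (betaOfRecord₁₃ F 2 (theta13OfThm1CCMW F 2 j γ ε₀ ε₂₉ B₃ B₃' a₀ a₁))) (hbox' : BetaUpperH β' γ (betaOfRecord₁₃ F 2 (theta13OfThm1CCMW F 2 j γ ε₀ ε₂₉ B₃ B₃' a₀ a₁))) (hl : -bl * γ ^ 2 ≤ 3) (hβ' : β' * γ ^ 2 ≤ 3 / 4),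
      ∃ lamW : ResidW F 2, (∀ P : B12.RunParams, B15Leaf (WOfRecord₁₃ F 2 (theta13OfThm1CCMW F 2 j γ ε₀ ε₂₉ B₃ B₃' a₀ a₁) lamW P)) ∧
      ∀ P : B12.RunParams, 1 ≤ P.K → lamW.kSel P < P.K)
    (hUVF : ∀ {j c : ℕ} {γ ε₀ ε₂₉ B₃ B₃' a₀ a₁ : ℝ} (hγ₀ : 0 < γ) (hγh : γ ≤ 1 / 2) (hε : 0 < ε₀) (hε' : 0 < ε₂₉) (hB : 0 ≤ B₃) (hB' : 0 ≤ B₃') (ha₀ : 0 < a₀) (ha₁ : 0 < a₁) (h15 : VariationalThm1RegSepCoP7M F 2 B₃ a₀ a₁) (hc : c ≤ F.L ^ j) (h9 : Gauge9RegSepTopStepR F 2 (fun ν K Ω => suppDomOfRecord F ν K Ω) (F.L ^ j) c B₃ B₃' a₀ a₁) {bl β' : ℝ} (hbox : BetaLowerH bl γ (betaOfRecord₁₃ F 2 (theta13OfThm1CCMW F 2 j γ ε₀ ε₂₉ B₃ B₃' a₀ a₁))) (hbox' : BetaUpperH β' γ (betaOfRecord₁₃ F 2 (theta13OfThm1CCMW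 F 2 j γ ε₀ ε₂₉ B₃ B₃' a₀ a₁))) (hl : -bl * γ ^ 2 ≤ 3) (hβ' : β' * γ ^ 2 ≤ 3 / 4),
      ∃ γ₁₃ : ℝ, 0 < γ₁₃ ∧ ∃ em ep : ℝ → ℝ, ∀ P : B12.RunParams, (genFlow (betaOfRecord₁₃ F 2 (theta13OfThm1CCMW F 2 j γ ε₀ ε₂₉ B₃ B₃' a₀ a₁)) P.g0).InInterval γ₁₃ P.K → ∀ k, k ≤ P.K → SLaw₁₃CoPH F 2 (Stage13HParams.ofHistoryBlind F 2 ⟨theta13OfThm1CCMW F 2 j γ ε₀ ε₂₉ B₃ B₃' a₀ a₁, ZrOfRecord₁₃ F 2 (theta13OfThm1CCMW F 2 j γ ε₀ ε₂₉ B₃ B₃' a₀ a₁)⟩) P k →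
      ∀ U : GaugeField (F.P P.K) k (SU 2),
        chiβOfRecord₁₃ F 2 (theta13OfThm1CCMW F 2 j γ ε₀ ε₂₉ B₃ B₃' a₀ a₁) P.K (gOfRecord₁₃ F 2 (theta13OfThm1CCMW F 2 j γ ε₀ ε₂₉ B₃ B₃' a₀ a₁) P) k U *
              Real.exp (-(1 / (gOfRecord₁₃ F 2 (theta13OfThm1CCMW F 2 j γ ε₀ ε₂₉ B₃ B₃' a₀ a₁) P k) ^ 2 * wilsonBGOfRecord F 2 (theta13OfThm1CCMW F 2 j γ ε₀ ε₂₉ B₃ B₃' a₀ a₁).εbg P k U)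
                - em (gOfRecord₁₃ F 2 (theta13OfThm1CCMW F 2 j γ ε₀ ε₂₉ B₃ B₃' a₀ a₁) P k) * (Fintype.card (Site (F.P P.K) k) : ℝ)) ≤ densOfRecord₁₃ F 2 (theta13OfThm1CCMW F 2 j γ ε₀ ε₂₉ B₃ B₃' a₀ a₁) P k U ∧
        densOfRecord₁₃ F 2 (theta13OfThm1CCMW F 2 j γ ε₀ ε₂₉ B₃ B₃' a₀ a₁) P k U ≤ Real.exp (ep (gOfRecord₁₃ F 2 (theta13OfThm1CCMW F 2 j γ ε₀ ε₂₉ B₃ B₃' a₀ a₁) P k) * (Fintype.card (Site (F.P P.K) k) : ℝ)))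
    (hrowsF : ∀ {j c : ℕ} {γ ε₀ ε₂₉ B₃ B₃' a₀ a₁ : ℝ} (hγ₀ : 0 < γ) (hγh : γ ≤ 1 / 2) (hε : 0 < ε₀) (hε' : 0 < ε₂₉) (hB : 0 ≤ B₃) (hB' : 0 ≤ B₃') (ha₀ : 0 < a₀) (ha₁ : 0 < a₁) (h15 : VariationalThm1RegSepCoP7M F 2 B₃ a₀ a₁) (hc : c ≤ F.L ^ j) (h9 : Gauge9RegSepTopStepR F 2 (fun ν K Ω => suppDomOfRecord F ν K Ω) (F.L ^ j) c B₃ B₃' a₀ a₁) {bl β' : ℝ} (hbox : BetaLowerH bl γ (betaOfRecord₁₃ F 2 (theta13OfThm1CCMW F 2 j γ ε₀ ε₂₉ B₃ B₃' a₀ a₁))) (hbox' : BetaUpperH β' γ (betaOfRecord₁₃ F 2 (theta13OfThm1CCMW F 2 j γ ε₀ ε₂₉ B₃ B₃' a₀ a₁))) (hl : -bl * γ ^ 2 ≤ 3) (hβ' : β' * γ ^ 2 ≤ 3 / 4),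
      ∃ (b : ℕ → ℝ) (r γR B M : ℝ), 0 < γR ∧ RunConstRemainder (betaOfRecord₁₃ F 2 (theta13OfThm1CCMW F 2 j γ ε₀ ε₂₉ B₃ B₃' a₀ a₁)) b r γR ∧ (∀ k, b k ≤ B) ∧
      ∀ (n : ℕ) (gs : ℕ → ℝ), RGEqH n (betaOfRecord₁₃ F 2 (theta13OfThm1CCMW F 2 j γ ε₀ ε₂₉ B₃ B₃' a₀ a₁)) gs → Step.InInterval γR n gs →
        ∀ k, k ≤ n → -M ≤ ∑ i ∈ Finset.Ico k n, betaOfRecord₁₃ F 2 (theta13OfThm1CCMW F 2 j γ ε₀ ε₂₉ B₃ B₃' a₀ a₁) i (prefixOf gs i)) :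
    ∃ (θ : Stage13HParams F 2) (hP : θ.Provisos₁₃SepCoPH F 2) (w : WorldP), (θ.ZhUnity F 2 ∧ θ.SlotsNondegenerate₁₃ F 2) ∧ θ.Admissible F 2 ∧
      (∃ (θ' : Stage13HParams F 2) (h' : θ'.Provisos₁₃SepCoPH F 2), θ'.Admissible F 2 ∧
      datumOfRecord₁₃SepCoPH F 2 θ hP = datumOfRecord₁₃SepCoPH F 2 θ' h' ∧ w.C = (datumOfRecord₁₃SepCoPH F 2 θ hP).C ∧ (0 < w.γ ∧ w.γ ≤ θ'.γ) ∧
      w.L = (θ'.L : ℝ) ∧ ∀ P : B12.RunParams, w.up P = upOfRecord₅CS F 2 (θ'.toStage5₁₃CoPH F 2) P) ∧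
      (∀ P : B12.RunParams, Nodes (leavesP w P)) ∧
      ∃ (b : ℕ → ℝ) (r γ₀ B M : ℝ), 0 < γ₀ ∧ RunConstRemainder (betaOfRecord₁₃ F 2 θ.toStage13Params) b r γ₀ ∧ (∀ k, b k ≤ B) ∧ B + r ≤ w.βup ∧
        ∀ (n : ℕ) (gs : ℕ → ℝ), RGEqH n (betaOfRecord₁₃ F 2 θ.toStage13Params) gs → Step.InInterval γ₀ n gs →
          ∀ k, k ≤ n → -M ≤ ∑ j ∈ Finset.Ico k n, betaOfRecord₁₃ F 2 θ.toStage13Params j (prefixOf gs j) := by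
  obtain ⟨B₃, a₀, a₁, hB₃, ha₀, ha₁, h8⟩ := h1F
  have hL0 : (0 : ℝ) < (F.L : ℝ) := by exact_mod_cast lt_trans Nat.zero_lt_one F.hL.2
  have hBpos : (0 : ℝ) < B₃ := lt_of_lt_of_le (mul_pos two_pos (pow_pos hL0 2)) hB₃
  obtain ⟨j, c, B₉, a₁', hc, hB9, ha₁', ha₁'le, h9⟩ := gauge9Supplier_of_prop6MemberP F h2PF B₃ a₀ a₁ hB₃ ha₀ ha₁ h8
  have h15 : VariationalThm1RegSepCoP7M F 2 B₃ a₀ a₁' := variationalThm1RegSepCoP7M_of_prop8TopStep hBpos (h8.of_le le_rfl ha₁'le)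
  obtain ⟨γ₀, ε₀, ε₂₉, β', hγ0, hε, hε', hlow, hup⟩ := h3A'F j c B₃ B₉ a₀ a₁' hc hB₃ hB9 ha₀ ha₁' h15 h9
  obtain ⟨γ, hγpos, hγh, hl, hu, hlow', hup'⟩ := windowLetters_of_absBetaBoxH hγ0 hlow hup
  have hloW := betaLowerH_theta13OfThm1CCMW_of_half (F := F) (N := 2) (j := j) (ε₀ := ε₀) (ε₂₉ := ε₂₉) (B₃ := B₃) (B₃' := B₉) (a₀ := a₀) (a₁ := a₁') hγh hlow'
  have hupW := betaUpperH_theta13OfThm1CCMW_of_half (F := F) (N := 2) (j := j) (ε₀ := ε₀) (ε₂₉ := ε₂₉) (B₃ := B₃) (B₃' := B₉) (a₀ := a₀) (a₁ := a₁') hγh hup'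
  obtain ⟨b, r, γR, B, M, hγR, hrem, hbB, hps⟩ := hrowsF hγpos hγh hε hε' hBpos.le hB9.le ha₀ ha₁' h15 hc h9 hloW hupW hl hu
  exact N24_runRowsAtSomeRecordS₁₃SepCoPH_worldBuilt_childrenSplit_theta13OfThm1CCMW_of_gauge9TopStepR_of_betaBoxSignFree_allTorus_door hγpos hγh hε hε' hBpos.le hB9.le ha₀ ha₁' h15 hc h9 hloW hupW hl hu
    (h05F hγpos hγh hε hε' hBpos.le hB9.le ha₀ ha₁' h15 hc h9 hloW hupW hl hu) (h06F hγpos hγh hε hε' hBpos.le hB9.le ha₀ ha₁' h15 hc h9 hloW hupW hl hu) h07 h08 (h09F hγpos hγh hε hε' hBpos.le hB9.le ha₀ ha₁' h15 hc h9 hloW hupW hl hu) (h09TF hγpos hγh hε hε' hBpos.le hB9.le ha₀ ha₁' h15 hc h9 hloW hupW hl hu) (h10F hγpos hγh hε hε' hBpos.le hB9.le ha₀ ha₁' h15 hc h9 hloW hupW hl hu) (h11F hγpos hγh hε hε' hBpos.le hB9.le ha₀ ha₁' h15 hc h9 hloW hupW hl hu) (h12F hγpos hγh hε hε' hBpos.le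 hB9.le ha₀ ha₁' h15 hc h9 hloW hupW hl hu) (hUVF hγpos hγh hε hε' hBpos.le hB9.le ha₀ ha₁' h15 hc h9 hloW hupW hl hu) hγR hrem hbB hps

end Summit.QuantumFields.YangMills.BalabanUVNodes.N24K1OfStubsV19ChildrenSplitRunRowsWorldBuilt

end
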